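import Literature.NumberTheory.Rogawski1990.RankOneUnstableDeltaSymbolTorusCoordinatesDepth   -- ★ p844075 (B-p12 (g30)): `valued_toPlace_bcoord_eq`, brings ★ p844015 (`hilbertSymbol_eq_mul_of_toPlace_eq_div`, the coordinates) and ★ R-4
import Literature.NumberTheory.Rogawski1990.RankOneTorusHilbertSymbolLocalConstancy         -- ★ p844089 (A-p03 (g26)) (W′5′-LC): `cast_hilbertSymbol_trc_eq_one_of_valued_sub_lt_four`; brings the torus pack ★ `RankOneTorusDepthContinuity`
import HarnessLib

/-!
# [LabesseLanglands1979 §2 (2.2); Labesse2024 Th. 0.0.12; Rogawski1990 Lemma 4.9.3] road «W′» = «R1LL-WILD», socket (Ψ4-book): THE BOOKKEEPING FACTOR IS CONSTANT ON THE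
# DEEP TORUS — `(b₀ t, θ)_v · (bc t, θ)_v · q^(ord_v bc t) · q^(−⌊(N t − 1)∕2⌋) = q^(−⌊(ord_w η − ord_w 2 − 1)∕2⌋)`

Topic `NumberTheory/Rogawski1990`; namespace `Literature.NumberTheory.Rogawski1990`.  THEOREMS ONLY (no definition, no instance, no notation, no named fact, no `sorry`).
Cell `pub/hodgecm-mathlib` (D-0151), crux H413 = `stmt-HodgeConjecture-24833`, line «N6nsGerm», wild residue `stub_N6nsR1ramWild` (★ def p843764); architect A-p16 (g28)
RULING A-44 output assignment (Ψ4-book) `(book, hbook, hbookU)` of the (γ) layer ★-to-be `rankOneUnstable_core_of_shellWindow` (F0P3a-p04 (g14)); hand B-p12 (g30), co-input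
A-p03 (g26) ★ p844089.  HONEST LABEL: HC_CM is proved only modulo the printed citations (2 remaining named inputs hLiu418, h413) until rung 0 closes; nothing printed is
asserted here — the content is bookkeeping of signs and exponents in Labesse's display.

THE MATHEMATICS (display of record (W′0) §D, A-37; tokens of ★ p844015).  Along the framed torus `Z(t₀) ⊂ H_v` at a RAMIFIED non-split `w ∣ v` (`e(w|v) = 2`), with
`a_t = τ₀ t`, `c_t = τ₁ t` the norm-one frame eigenvalues, `z t = a_t∕c_t`, depth `N t = ord_w(a_t − c_t)`, a FIXED skew `η ≠ 0` and `θ` the CM generator: on the deep regular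
locus there are units `b₀ t, bc t, tc t ∈ L⁺_vˣ` with `ι_w b₀ = (z−1)∕((z+1)η)` (R-4's Cayley parameter), `ι_w bc = (z − z⁻¹)∕η`, `ι_w tc = z + z⁻¹ + 2` (★ p844015), and
(1) SIGN: `(b₀,θ)_v·(bc,θ)_v = (tc,θ)_v = 1` (split ★ `hilbertSymbol_eq_mul_of_toPlace_eq_div` + ★ A-p03 `(tc,θ)_v = 1` once `|a − c|_w < |4|_w`);
(2) EXPONENT: `N t = 2·ord_v(bc t) + (ord_w η − ord_w 2)` (★ `valued_toPlace_bcoord_eq`: `|ι bc|_w = |a−c|_w|2|_w∕|η|_w`, and `|ι y|_w = |y|_v²`), hence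
`q^(ord_v bc)·q^(−⌊(N−1)∕2⌋) = q^(−⌊(c−1)∕2⌋)`, `c := ord_w η − ord_w 2` — a CONSTANT.
So the layer's `book t := ε t·κβ t·q^(oβ t)·(q^((N t−1)∕2))⁻¹` (`ε = (b₀,θ)`, `κβ = (bc,θ)`, `oβ = ord_v bc`) IS the constant `K = q^(−⌊(c−1)∕2⌋)` on the deep locus: `hbook` is
trivial and `hbookU` is the HEAD below.
* §1 `zpow` arithmetic `pow_mul_inv_pow_half_eq_zpow`; `ℤₘ₀` bookkeeping `valued_lt_of_toNat_succ_le`, `natCast_toNat_neg_log_eq`.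
* §2 one place (R-4 tokens): `cast_hilbertSymbol_mul_cast_hilbertSymbol_bcoord_eq_one` (SIGN), `two_mul_log_valued_bcoord_eq` (EXPONENT).
* §3 torus: HEAD `exists_const_bookProduct` (exports `Nb, b₀, bc, tc, K` with the three pointwise specs and the constancy), `exists_book_of_ramified` = the layer's
  `(book, hbook, hbookU)` literally (`book := fun _ => K`), and `exists_book_of_wildLaw` = the same for ANY `κβ, oβ` meeting the (W′-B6) contract's specs
  `κβ t = (bc t, θ)_v`, `|ι_w(bc t)|_w = exp(−2·oβ t)` (F0P3-p01 (g14) v1) — `toNat_neg_log_eq_of_valued_toPlace_eq_exp` reads the depth spec.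
NOT here: `hO` ((W′-B6) F0P3-p01 (g14): if its `κβ, oβ` are read on another numerator∕skew, the adapter is ★ `toPlace_cayley_eq_div_of_numerator_coords` — ED. 2), `hΔ`∕`hE` ((Ψ4-Δ) A-p19 (g23): stated
∀ `b₀` with the Cayley spec, it applies to the `b₀` exported here — two spec-satisfying functions agree on the deep locus by injectivity of `ι_w`).

## References
* [LabesseLanglands1979] J.-P. Labesse, R. P. Langlands, *L-indistinguishability for SL(2)*, Canad. J. Math. 31 (1979): §2 (2.1)–(2.2) pp. 8–9 (`δ_m = 2q^m`, the weight `κ(b)`, `|b|`).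
* [Labesse2024StabilisationGermesSL2] J.-P. Labesse, *Stabilisation des germes de SL(2)* (arXiv:2411.14820, 2024): Prop. 0.0.11, Th. 0.0.12 pp. 7–8.
* [Rogawski1990] J. D. Rogawski, *Automorphic Representations of Unitary Groups in Three Variables*, Ann. of Math. Stud. 123 (1990): §4.9 Lemma 4.9.3, (4.9.2) p. 56; p. 55.
-/

set_option autoImplicit false

noncomputable section

open NumberField IsDedekindDomain Filter Topology ValuativeRel
open scoped ValuativeRel Matrix MatrixGroups

namespace Literature.NumberTheory.Rogawski1990

open Literature.NumberTheory.Automorphic Literature.NumberTheory.Automorphic.UnitaryGroup Literature.NumberTheory.GaloisRepresentations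
open Literature.NumberTheory.QuadraticForms Literature.NumberTheory.NumberFields

/-! ## §1 Arithmetic and `ℤₘ₀` bookkeeping -/

section Arith

/-- **`q^o · (q^((N − 1)∕2))⁻¹ = q^(−⌊(c − 1)∕2⌋)` when `N = 2o + c`, `N ≥ 1`** (ℕ-division on the left, `ℤ`-floor-division on the right): the exponent bookkeeping of the
display `κ(β)·q^(ord β)` against `q^((N−1)∕2)`. [cite: LabesseLanglands1979, §2 (2.2) p. 9] [cite: Labesse2024StabilisationGermesSL2, Th. 0.0.12] -/
theorem pow_mul_inv_pow_half_eq_zpow {q : ℂ} (hq : q ≠ 0) {N o : ℕ} {c : ℤ} (hN : (N : ℤ) = 2 * o + c) (hN1 : 1 ≤ N) :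
    q ^ o * (q ^ ((N - 1) / 2))⁻¹ = q ^ (-((c - 1) / 2)) := by
  have h1 : (((N - 1) / 2 : ℕ) : ℤ) = (o : ℤ) + (c - 1) / 2 := by omega
  rw [← zpow_natCast q ((N - 1) / 2), ← zpow_natCast q o, h1, ← zpow_neg, ← zpow_add₀ hq]
  congr 1
  ring

variable {K : Type*} [Field K] [Valued K (WithZero (Multiplicative ℤ))]

/-- **DEPTH ⇒ SMALLNESS**: for `x ≠ 0` with `|x| ≤ 1` and `π ≠ 0`, `(−log|π|).toNat + 1 ≤ (−log|x|).toNat ⇒ |x| < |π|`. [cite: Rogawski1990, §4.9 p. 55] -/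
theorem valued_lt_of_toNat_succ_le {x π : K} (hx : x ≠ 0) (hx1 : Valued.v x ≤ 1) (hπ : π ≠ 0)
    (h : (-WithZero.log (Valued.v π)).toNat + 1 ≤ (-WithZero.log (Valued.v x)).toNat) : Valued.v x < Valued.v π := by
  have hvx : Valued.v x ≠ 0 := (Valuation.ne_zero_iff _).2 hx
  have hvπ : Valued.v π ≠ 0 := (Valuation.ne_zero_iff _).2 hπ
  have hlog : WithZero.log (Valued.v x) ≤ 0 := (WithZero.log_le_iff_le_exp hvx).2 (by rwa [WithZero.exp_zero])
  have hN : ((-WithZero.log (Valued.v x)).toNat : ℤ) = -WithZero.log (Valued.v x) := Int.toNat_of_nonneg (neg_nonneg.2 hlog)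
  have hπ' : -WithZero.log (Valued.v π) ≤ ((-WithZero.log (Valued.v π)).toNat : ℤ) := Int.self_le_toNat _
  have h' : ((-WithZero.log (Valued.v π)).toNat : ℤ) + 1 ≤ ((-WithZero.log (Valued.v x)).toNat : ℤ) := by exact_mod_cast h
  exact (WithZero.log_lt_log hvx hvπ).1 (by omega)

/-- **THE DEPTH AS AN INTEGER**: for `x ≠ 0`, `|x| ≤ 1`: `((−log|x|).toNat : ℤ) = −log|x|`. [cite: Rogawski1990, §4.9 p. 55] -/
theorem natCast_toNat_neg_log_eq {x : K} (hx : x ≠ 0) (hx1 : Valued.v x ≤ 1) :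
    ((-WithZero.log (Valued.v x)).toNat : ℤ) = -WithZero.log (Valued.v x) := by
  have hvx : Valued.v x ≠ 0 := (Valuation.ne_zero_iff _).2 hx
  have hlog : WithZero.log (Valued.v x) ≤ 0 := (WithZero.log_le_iff_le_exp hvx).2 (by rwa [WithZero.exp_zero])
  exact Int.toNat_of_nonneg (neg_nonneg.2 hlog)

end Arith

/-! ## §2 One place, R-4 tokens: the sign line and the exponent line -/

/-- `((a, b)_F : ℂ)² = 1` — the Hilbert symbol is `±1`. [cite: LabesseLanglands1979, §2 (2.2) p. 9] -/
private theorem cast_hilbertSymbol_mul_self {F : Type*} [Field F] (a b : F) : ((hilbertSymbol F a b : ℤ) : ℂ) * ((hilbertSymbol F a b : ℤ) : ℂ) = 1 := by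
  unfold hilbertSymbol
  split_ifs <;> norm_num

section OnePlace

variable (L : Type) [Field L] [NumberField L] [IsCMField L] (v : HeightOneSpectrum (𝓞 ↥(maximalRealSubfield L)))
  (w : PlacesOver L v) (hw : IsCMField.complexConj L • w.1 = w.1)

include hw in
/-- **SIGN LINE**: for norm-one `a, c` with `|a_w − c_w|_w < |4|_w` and units `b₀ bc tc` with `ι b₀ = (z−1)∕((z+1)η)`, `ι bc = (z − z⁻¹)∕η`, `ι tc = z + z⁻¹ + 2`
(`z = a_w∕c_w`): `(b₀,θ)_v · (bc,θ)_v = 1` — `(b₀,θ) = (bc,θ)(tc,θ)` (★ split), `(bc,θ)² = 1`, `(tc,θ) = 1` (★ A-p03). [cite: Labesse2024StabilisationGermesSL2, Prop. 0.0.11]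
[cite: LabesseLanglands1979, §2 (2.2) p. 9] -/
theorem cast_hilbertSymbol_mul_cast_hilbertSymbol_bcoord_eq_one {η : w.1.adicCompletion L} {a c : LocalRing L v}
    (ha : conjLocal L (IsCMField.complexConj L) v a * a = 1) (hc : conjLocal L (IsCMField.complexConj L) v c * c = 1)
    (hdeep : Valued.v (a w - c w) < Valued.v (4 : w.1.adicCompletion L)) (hne' : a w ≠ -c w)
    {b₀ bc tc : (v.adicCompletion ↥(maximalRealSubfield L))ˣ}
    (hb₀ : toPlace v w ((b₀ : (v.adicCompletion ↥(maximalRealSubfield L))ˣ) : v.adicCompletion ↥(maximalRealSubfield L)) = (a w / c w - 1) / ((a w / c w + 1) * η))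
    (hbc : toPlace v w ((bc : (v.adicCompletion ↥(maximalRealSubfield L))ˣ) : v.adicCompletion ↥(maximalRealSubfield L)) = (a w / c w - c w / a w) / η)
    (htc : toPlace v w ((tc : (v.adicCompletion ↥(maximalRealSubfield L))ˣ) : v.adicCompletion ↥(maximalRealSubfield L)) = a w / c w + c w / a w + 2) :
    ((hilbertSymbol (v.adicCompletion ↥(maximalRealSubfield L)) ((b₀ : (v.adicCompletion ↥(maximalRealSubfield L))ˣ) : v.adicCompletion ↥(maximalRealSubfield L)) (algebraMap ↥(maximalRealSubfield L) _ ((cmQuadraticGenerator L : 𝓞 ↥(maximalRealSubfield L)) : ↥(maximalRealSubfield L))) : ℤ) : ℂ) * ((hilbertSymbol (v.adicCompletion ↥(maximalRealSubfield L)) ((bc : (v.adicCompletion ↥(maximalRealSubfield L))ˣ) : v.adicCompletion ↥(maximalRealSubfield L)) (algebraMap ↥(maximalRealSubfield L) _ ((cmQuadraticGenerator L : 𝓞 ↥(maximalRealSubfield L)) : ↥(maximalRealSubfield L))) : ℤ) : ℂ) = 1 := by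
  have hva : Valued.v (a w) = 1 := valued_apply_eq_one_of_conjLocal_mul_self L v w hw ha
  have hvc : Valued.v (c w) = 1 := valued_apply_eq_one_of_conjLocal_mul_self L v w hw hc
  have ha0 : a w ≠ 0 := fun h0 => by rw [h0, map_zero] at hva; exact zero_ne_one hva
  have hc0 : c w ≠ 0 := fun h0 => by rw [h0, map_zero] at hvc; exact zero_ne_one hvc
  have hθ0 : algebraMap ↥(maximalRealSubfield L) _ ((cmQuadraticGenerator L : 𝓞 ↥(maximalRealSubfield L)) : ↥(maximalRealSubfield L)) ≠ (0 : v.adicCompletion ↥(maximalRealSubfield L)) := by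
    rw [Ne, map_eq_zero_iff _ (algebraMap ↥(maximalRealSubfield L) (v.adicCompletion ↥(maximalRealSubfield L))).injective]
    exact fun h => not_isSquare_cmQuadraticGenerator L (by rw [h]; exact IsSquare.zero)
  have hsplit : toPlace v w ((b₀ : (v.adicCompletion ↥(maximalRealSubfield L))ˣ) : v.adicCompletion ↥(maximalRealSubfield L)) = toPlace v w ((bc : (v.adicCompletion ↥(maximalRealSubfield L))ˣ) : v.adicCompletion ↥(maximalRealSubfield L)) / toPlace v w ((tc : (v.adicCompletion ↥(maximalRealSubfield L))ˣ) : v.adicCompletion ↥(maximalRealSubfield L)) := by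
    rw [hb₀, ← toPlace_cayley_eq_div_of_coords L v w ha0 hc0 hne' hbc htc, Units.val_mul, Units.val_inv_eq_inv_val, map_mul, map_inv₀,
      div_eq_mul_inv]
  rw [cast_hilbertSymbol_eq_mul_of_toPlace_eq_div L v w b₀ bc tc hsplit hθ0, cast_hilbertSymbol_trc_eq_one_of_valued_sub_lt_four L v w hw ha hc htc hdeep, mul_one,
    cast_hilbertSymbol_mul_self]

include hw in
/-- **EXPONENT LINE**: for norm-one `a, c` with `|a_w − c_w|_w < |2|_w`, a skew `η ≠ 0` and the difference coordinate `bc` (`ι bc = (z − z⁻¹)∕η`), at a RAMIFIED place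
(`e(w|v) = 2`): `2·log|bc|_v = log|a_w − c_w|_w + log|2|_w − log|η|_w` — i.e. `N = 2·ord_v bc + ord_w η − ord_w 2`.
[cite: LabesseLanglands1979, §2 (2.2) p. 9 (`|b|`)] [cite: Labesse2024StabilisationGermesSL2, Th. 0.0.12] -/
theorem two_mul_log_valued_bcoord_eq (he : v.asIdeal.ramificationIdx' w.1.asIdeal ≠ 1) {η : w.1.adicCompletion L} (hη0 : η ≠ 0) {a c : LocalRing L v}
    (ha : conjLocal L (IsCMField.complexConj L) v a * a = 1) (hc : conjLocal L (IsCMField.complexConj L) v c * c = 1)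
    (hdeep : Valued.v (a w - c w) < Valued.v (2 : w.1.adicCompletion L)) (hac : a w - c w ≠ 0)
    {bc : (v.adicCompletion ↥(maximalRealSubfield L))ˣ} (hbc : toPlace v w ((bc : (v.adicCompletion ↥(maximalRealSubfield L))ˣ) : v.adicCompletion ↥(maximalRealSubfield L)) = (a w / c w - c w / a w) / η) :
    2 * WithZero.log (Valued.v ((bc : (v.adicCompletion ↥(maximalRealSubfield L))ˣ) : v.adicCompletion ↥(maximalRealSubfield L))) =
      WithZero.log (Valued.v (a w - c w)) + WithZero.log (Valued.v (2 : w.1.adicCompletion L)) - WithZero.log (Valued.v η) := by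
  haveI : CharZero (w.1.adicCompletion L) := charZero_of_injective_algebraMap (algebraMap L (w.1.adicCompletion L)).injective
  have hc1 : IsCMField.complexConj L ≠ 1 := IsCMField.complexConj_ne_one L
  have he2 : v.asIdeal.ramificationIdx' w.1.asIdeal = 2 := Liu2021.LemD1IndexedNonVacuityRamifiedPlace.ramificationIdx'_eq_two_of_ne_one L v (IsCMField.complexConj L) hc1 w hw he
  have hval := valued_toPlace_bcoord_eq L v w hw hη0 ha hc hdeep hbc
  rw [valued_toPlace, he2] at hval
  have h2 : Valued.v (2 : w.1.adicCompletion L) ≠ 0 := (Valuation.ne_zero_iff _).2 two_ne_zero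
  have hη : Valued.v η ≠ 0 := (Valuation.ne_zero_iff _).2 hη0
  have hacv : Valued.v (a w - c w) ≠ 0 := (Valuation.ne_zero_iff _).2 hac
  have hbcv : Valued.v ((bc : (v.adicCompletion ↥(maximalRealSubfield L))ˣ) : v.adicCompletion ↥(maximalRealSubfield L)) ≠ 0 := (Valuation.ne_zero_iff _).2 bc.ne_zero
  have hlog := congrArg WithZero.log hval
  rw [WithZero.log_pow, WithZero.log_mul (mul_ne_zero hacv h2) (inv_ne_zero hη), WithZero.log_mul hacv h2, WithZero.log_inv] at hlog
  simp only [nsmul_eq_mul, Nat.cast_ofNat] at hlog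
  linarith

include hw in
/-- **THE THREE COORDINATES EXIST** at a pair of norm-one `a, c` with `a_w ≠ ± c_w` (skew `η ≠ 0`): units `b₀, bc, tc` of `L⁺_v` with `ι b₀ = (z−1)∕((z+1)η)`,
`ι bc = (z − z⁻¹)∕η`, `ι tc = z + z⁻¹ + 2`, `z = a_w∕c_w` (★ R-4 `exists_units_toPlace_eq_cayley_div`, ★ p844015). [cite: LabesseLanglands1979, §2 (2.1)]
[cite: Labesse2024StabilisationGermesSL2, Prop. 0.0.11] -/
theorem exists_units_coords {η : w.1.adicCompletion L} (hση : galAdicCompletionMap (L := L) (IsCMField.complexConj L) hw η = -η) (hη0 : η ≠ 0)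
    {a c : LocalRing L v} (ha : conjLocal L (IsCMField.complexConj L) v a * a = 1) (hc : conjLocal L (IsCMField.complexConj L) v c * c = 1)
    (hne : a w ≠ c w) (hne' : a w ≠ -c w) :
    ∃ p : (v.adicCompletion ↥(maximalRealSubfield L))ˣ × (v.adicCompletion ↥(maximalRealSubfield L))ˣ × (v.adicCompletion ↥(maximalRealSubfield L))ˣ,
      toPlace v w ((p.1 : (v.adicCompletion ↥(maximalRealSubfield L))ˣ) : v.adicCompletion ↥(maximalRealSubfield L)) = (a w / c w - 1) / ((a w / c w + 1) * η) ∧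
      toPlace v w ((p.2.1 : (v.adicCompletion ↥(maximalRealSubfield L))ˣ) : v.adicCompletion ↥(maximalRealSubfield L)) = (a w / c w - c w / a w) / η ∧
      toPlace v w ((p.2.2 : (v.adicCompletion ↥(maximalRealSubfield L))ˣ) : v.adicCompletion ↥(maximalRealSubfield L)) = a w / c w + c w / a w + 2 := by
  have ha1 := galAdicCompletionMap_apply_mul_self_of_conjLocal L v w hw ha
  have hc1 := galAdicCompletionMap_apply_mul_self_of_conjLocal L v w hw hc
  have hc0 : c w ≠ 0 := fun h0 => by rw [h0, mul_zero] at hc1; exact zero_ne_one hc1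
  have hz : galAdicCompletionMap (L := L) (IsCMField.complexConj L) hw (a w / c w) * (a w / c w) = 1 := by
    rw [map_div₀, div_mul_div_comm, ha1, hc1, div_one]
  have hz1 : a w / c w - 1 ≠ 0 := by rw [sub_ne_zero, Ne, div_eq_one_iff_eq hc0]; exact hne
  have hz1' : a w / c w + 1 ≠ 0 := by
    rw [div_add_one hc0]; exact div_ne_zero (fun h => hne' (eq_neg_of_add_eq_zero_left h)) hc0
  obtain ⟨b₀, hb₀⟩ := exists_units_toPlace_eq_cayley_div L v w hw hση hη0 hz hz1' hz1
  obtain ⟨bc, hbc⟩ := exists_units_toPlace_eq_bcoord_of_normOne L v w hw hση hη0 ha hc hne hne'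
  obtain ⟨tc, htc⟩ := exists_units_toPlace_eq_trc_of_normOne L v w hw ha hc hne'
  exact ⟨(b₀, bc, tc), hb₀, hbc, htc⟩

end OnePlace

/-! ## §3 Along the torus: the bookkeeping factor is constant on the deep regular locus — `(book, hbook, hbookU)` -/

section Torus

variable (L : Type) [Field L] [NumberField L] [IsCMField L] (v : HeightOneSpectrum (𝓞 ↥(maximalRealSubfield L)))
  (w : PlacesOver L v) (hw : IsCMField.complexConj L • w.1 = w.1) (he : v.asIdeal.ramificationIdx' w.1.asIdeal ≠ 1)
  (t₀ : ((cmDatum L 2 (Matrix.of fun i j : Fin 2 => if i.val + j.val + 1 = 2 then (1 : L) else 0)).Local v × (cmDatum L 1 (Matrix.of fun i j : Fin 1 => if i.val + j.val + 1 = 1 then (1 : L) else 0)).Local v)) (P : GL (Fin 2) (LocalRing L v)) (d : Fin 2 → LocalRing L v)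
  (ht₀ : IsRegularElt (t₀.1.val : GL (Fin 2) (LocalRing L v)))
  (hP : (t₀.1.val.val : Matrix (Fin 2) (Fin 2) (LocalRing L v)) * P.val = P.val * Matrix.diagonal d) (hd1 : ∀ i, conjLocal L (IsCMField.complexConj L) v (d i) * d i = 1)

include hw he ht₀ hP hd1

-- `L_w`-sized statement: elaboration budget only (no search)
set_option maxHeartbeats 1600000 in
/-- **HEAD (Ψ4-book) — THE BOOKKEEPING FACTOR IS CONSTANT ON THE DEEP TORUS.**  At a ramified non-split `w ∣ v`, along the framed torus `Z(t₀)`, for a fixed skew `η ≠ 0`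
there are a depth `Nb`, FUNCTIONS `b₀ bc tc : Z(t₀) → L⁺_vˣ` and a constant `K ≠ 0` (`K = q^(−⌊(ord_w η − ord_w 2 − 1)∕2⌋)`) such that for every regular `t` of depth `N t ≥ Nb`:
`ι_w(b₀ t) = (z−1)∕((z+1)η)` (R-4's Cayley parameter — feed THIS `b₀` to the `Δ`-side), `ι_w(bc t) = (z−z⁻¹)∕η`, `ι_w(tc t) = z+z⁻¹+2` (`z = (τ₀ t)_w∕(τ₁ t)_w`), and
`(b₀ t,θ)_v · (bc t,θ)_v · q^(ord_v bc t) · (q^((N t − 1)∕2))⁻¹ = K`.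
[cite: LabesseLanglands1979, §2 (2.2) p. 9] [cite: Labesse2024StabilisationGermesSL2, Prop. 0.0.11, Th. 0.0.12] [cite: Rogawski1990, §4.9 Lemma 4.9.3 (4.9.2) p. 56] -/
theorem exists_const_bookProduct {η : w.1.adicCompletion L} (hση : galAdicCompletionMap (L := L) (IsCMField.complexConj L) hw η = -η) (hη0 : η ≠ 0) :
    ∃ (Nb : ℕ) (b₀ bc tc : ↥(Subgroup.centralizer ({t₀} : Set ((cmDatum L 2 (Matrix.of fun i j : Fin 2 => if i.val + j.val + 1 = 2 then (1 : L) else 0)).Local v × (cmDatum L 1 (Matrix.of fun i j : Fin 1 => if i.val + j.val + 1 = 1 then (1 : L) else 0)).Local v))) → (v.adicCompletion ↥(maximalRealSubfield L))ˣ) (K : ℂ), K ≠ 0 ∧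
      (∀ t : ↥(Subgroup.centralizer ({t₀} : Set ((cmDatum L 2 (Matrix.of fun i j : Fin 2 => if i.val + j.val + 1 = 2 then (1 : L) else 0)).Local v × (cmDatum L 1 (Matrix.of fun i j : Fin 1 => if i.val + j.val + 1 = 1 then (1 : L) else 0)).Local v))), IsRegularElt ((t : ((cmDatum L 2 (Matrix.of fun i j : Fin 2 => if i.val + j.val + 1 = 2 then (1 : L) else 0)).Local v × (cmDatum L 1 (Matrix.of fun i j : Fin 1 => if i.val + j.val + 1 = 1 then (1 : L) else 0)).Local v)).1.val : GL (Fin 2) (LocalRing L v)) → Nb ≤ (-WithZero.log (Valued.v ((((P⁻¹).val * ((t : ((cmDatum L 2 (Matrix.of fun i j : Fin 2 => if i.val + j.val + 1 = 2 then (1 : L) else 0)).Local v × (cmDatum L 1 (Matrix.of fun i j : Fin 1 => if i.val + j.val + 1 = 1 then (1 : L) else 0)).Local v)).1.val.val : Matrix (Fin 2) (Fin 2) (LocalRing L v)) * P.val) 0 0 - ((P⁻¹).val * ((t : ((cmDatum L 2 (Matrix.of fun i j : Fin 2 => if i.val + j.val + 1 = 2 then (1 : L) else 0)).Local v × (cmDatum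 L 1 (Matrix.of fun i j : Fin 1 => if i.val + j.val + 1 = 1 then (1 : L) else 0)).Local v)).1.val.val : Matrix (Fin 2) (Fin 2) (LocalRing L v)) * P.val) 1 1) w))).toNat →
        toPlace v w ((b₀ t : (v.adicCompletion ↥(maximalRealSubfield L))ˣ) : v.adicCompletion ↥(maximalRealSubfield L)) = (((P⁻¹).val * ((t : ((cmDatum L 2 (Matrix.of fun i j : Fin 2 => if i.val + j.val + 1 = 2 then (1 : L) else 0)).Local v × (cmDatum L 1 (Matrix.of fun i j : Fin 1 => if i.val + j.val + 1 = 1 then (1 : L) else 0)).Local v)).1.val.val : Matrix (Fin 2) (Fin 2) (LocalRing L v)) * P.val) 0 0 w / ((P⁻¹).val * ((t : ((cmDatum L 2 (Matrix.of fun i j : Fin 2 => if i.val + j.val + 1 = 2 then (1 : L) else 0)).Local v × (cmDatum L 1 (Matrix.of fun i j : Fin 1 => if i.val + j.val + 1 = 1 then (1 : L) else 0)).Local v)).1.val.val : Matrix (Fin 2) (Fin 2) (LocalRing L v)) * P.val) 1 1 w - 1) / ((((P⁻¹).val * ((t : ((cmDatum L 2 (Matrix.of fun i j : Fin 2 =>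 if i.val + j.val + 1 = 2 then (1 : L) else 0)).Local v × (cmDatum L 1 (Matrix.of fun i j : Fin 1 => if i.val + j.val + 1 = 1 then (1 : L) else 0)).Local v)).1.val.val : Matrix (Fin 2) (Fin 2) (LocalRing L v)) * P.val) 0 0 w / ((P⁻¹).val * ((t : ((cmDatum L 2 (Matrix.of fun i j : Fin 2 => if i.val + j.val + 1 = 2 then (1 : L) else 0)).Local v × (cmDatum L 1 (Matrix.of fun i j : Fin 1 => if i.val + j.val + 1 = 1 then (1 : L) else 0)).Local v)).1.val.val : Matrix (Fin 2) (Fin 2) (LocalRing L v)) * P.val) 1 1 w + 1) * η) ∧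
        toPlace v w ((bc t : (v.adicCompletion ↥(maximalRealSubfield L))ˣ) : v.adicCompletion ↥(maximalRealSubfield L)) = (((P⁻¹).val * ((t : ((cmDatum L 2 (Matrix.of fun i j : Fin 2 => if i.val + j.val + 1 = 2 then (1 : L) else 0)).Local v × (cmDatum L 1 (Matrix.of fun i j : Fin 1 => if i.val + j.val + 1 = 1 then (1 : L) else 0)).Local v)).1.val.val : Matrix (Fin 2) (Fin 2) (LocalRing L v)) * P.val) 0 0 w / ((P⁻¹).val * ((t : ((cmDatum L 2 (Matrix.of fun i j : Fin 2 => if i.val + j.val + 1 = 2 then (1 : L) else 0)).Local v × (cmDatum L 1 (Matrix.of fun i j : Fin 1 => if i.val + j.val + 1 = 1 then (1 : L) else 0)).Local v)).1.val.val : Matrix (Fin 2) (Fin 2) (LocalRing L v)) * P.val) 1 1 w - ((P⁻¹).val * ((t : ((cmDatum L 2 (Matrix.of fun i j : Fin 2 => if i.val + j.val + 1 = 2 then (1 : L) else 0)).Local v × (cmDatum L 1 (Matrix.of fun i j : Fin 1 => if i.val + j.val + 1 = 1 then (1 : L) else 0)).Local v)).1.val.val : Matrix (Fin 2) (Fin 2)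 (LocalRing L v)) * P.val) 1 1 w / ((P⁻¹).val * ((t : ((cmDatum L 2 (Matrix.of fun i j : Fin 2 => if i.val + j.val + 1 = 2 then (1 : L) else 0)).Local v × (cmDatum L 1 (Matrix.of fun i j : Fin 1 => if i.val + j.val + 1 = 1 then (1 : L) else 0)).Local v)).1.val.val : Matrix (Fin 2) (Fin 2) (LocalRing L v)) * P.val) 0 0 w) / η ∧
        toPlace v w ((tc t : (v.adicCompletion ↥(maximalRealSubfield L))ˣ) : v.adicCompletion ↥(maximalRealSubfield L)) = ((P⁻¹).val * ((t : ((cmDatum L 2 (Matrix.of fun i j : Fin 2 => if i.val + j.val + 1 = 2 then (1 : L) else 0)).Local v × (cmDatum L 1 (Matrix.of fun i j : Fin 1 => if i.val + j.val + 1 = 1 then (1 : L) else 0)).Local v)).1.val.val : Matrix (Fin 2) (Fin 2) (LocalRing L v)) * P.val) 0 0 w / ((P⁻¹).val * ((t : ((cmDatum L 2 (Matrix.of fun i j : Fin 2 => if i.val + j.val + 1 = 2 then (1 : L) else 0)).Local v × (cmDatum L 1 (Matrix.of fun i j : Fin 1 => if i.val + j.val + 1 = 1 then (1 : L) else 0)).Local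 v)).1.val.val : Matrix (Fin 2) (Fin 2) (LocalRing L v)) * P.val) 1 1 w + ((P⁻¹).val * ((t : ((cmDatum L 2 (Matrix.of fun i j : Fin 2 => if i.val + j.val + 1 = 2 then (1 : L) else 0)).Local v × (cmDatum L 1 (Matrix.of fun i j : Fin 1 => if i.val + j.val + 1 = 1 then (1 : L) else 0)).Local v)).1.val.val : Matrix (Fin 2) (Fin 2) (LocalRing L v)) * P.val) 1 1 w / ((P⁻¹).val * ((t : ((cmDatum L 2 (Matrix.of fun i j : Fin 2 => if i.val + j.val + 1 = 2 then (1 : L) else 0)).Local v × (cmDatum L 1 (Matrix.of fun i j : Fin 1 => if i.val + j.val + 1 = 1 then (1 : L) else 0)).Local v)).1.val.val : Matrix (Fin 2) (Fin 2) (LocalRing L v)) * P.val) 0 0 w + 2) ∧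
      ∀ t : ↥(Subgroup.centralizer ({t₀} : Set ((cmDatum L 2 (Matrix.of fun i j : Fin 2 => if i.val + j.val + 1 = 2 then (1 : L) else 0)).Local v × (cmDatum L 1 (Matrix.of fun i j : Fin 1 => if i.val + j.val + 1 = 1 then (1 : L) else 0)).Local v))), IsRegularElt ((t : ((cmDatum L 2 (Matrix.of fun i j : Fin 2 => if i.val + j.val + 1 = 2 then (1 : L) else 0)).Local v × (cmDatum L 1 (Matrix.of fun i j : Fin 1 => if i.val + j.val + 1 = 1 then (1 : L) else 0)).Local v)).1.val : GL (Fin 2) (LocalRing L v)) → Nb ≤ (-WithZero.log (Valued.v ((((P⁻¹).val * ((t : ((cmDatum L 2 (Matrix.of fun i j : Fin 2 => if i.val + j.val + 1 = 2 then (1 : L) else 0)).Local v × (cmDatum L 1 (Matrix.of fun i j : Fin 1 => if i.val + j.val + 1 = 1 then (1 : L) else 0)).Local v)).1.val.val : Matrix (Fin 2) (Fin 2) (LocalRing L v)) * P.val) 0 0 - ((P⁻¹).val * ((t : ((cmDatum L 2 (Matrix.of fun i j : Fin 2 => if i.val + j.val + 1 = 2 then (1 : L) else 0)).Local v × (cmDatum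 L 1 (Matrix.of fun i j : Fin 1 => if i.val + j.val + 1 = 1 then (1 : L) else 0)).Local v)).1.val.val : Matrix (Fin 2) (Fin 2) (LocalRing L v)) * P.val) 1 1) w))).toNat →
        ((hilbertSymbol (v.adicCompletion ↥(maximalRealSubfield L)) ((b₀ t : (v.adicCompletion ↥(maximalRealSubfield L))ˣ) : v.adicCompletion ↥(maximalRealSubfield L)) (algebraMap ↥(maximalRealSubfield L) _ ((cmQuadraticGenerator L : 𝓞 ↥(maximalRealSubfield L)) : ↥(maximalRealSubfield L))) : ℤ) : ℂ) * ((hilbertSymbol (v.adicCompletion ↥(maximalRealSubfield L)) ((bc t : (v.adicCompletion ↥(maximalRealSubfield L))ˣ) : v.adicCompletion ↥(maximalRealSubfield L)) (algebraMap ↥(maximalRealSubfield L) _ ((cmQuadraticGenerator L : 𝓞 ↥(maximalRealSubfield L)) : ↥(maximalRealSubfield L))) : ℤ) : ℂ) * (Nat.card (𝓞 ↥(maximalRealSubfield L) ⧸ v.asIdeal) : ℂ) ^ (-WithZero.log (Valued.v ((bc t : (v.adicCompletion ↥(maximalRealSubfield L))ˣ) : v.adicCompletion ↥(maximalRealSubfield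 L)))).toNat * ((Nat.card (𝓞 ↥(maximalRealSubfield L) ⧸ v.asIdeal) : ℂ) ^ (((-WithZero.log (Valued.v ((((P⁻¹).val * ((t : ((cmDatum L 2 (Matrix.of fun i j : Fin 2 => if i.val + j.val + 1 = 2 then (1 : L) else 0)).Local v × (cmDatum L 1 (Matrix.of fun i j : Fin 1 => if i.val + j.val + 1 = 1 then (1 : L) else 0)).Local v)).1.val.val : Matrix (Fin 2) (Fin 2) (LocalRing L v)) * P.val) 0 0 - ((P⁻¹).val * ((t : ((cmDatum L 2 (Matrix.of fun i j : Fin 2 => if i.val + j.val + 1 = 2 then (1 : L) else 0)).Local v × (cmDatum L 1 (Matrix.of fun i j : Fin 1 => if i.val + j.val + 1 = 1 then (1 : L) else 0)).Local v)).1.val.val : Matrix (Fin 2) (Fin 2) (LocalRing L v)) * P.val) 1 1) w))).toNat - 1) / 2))⁻¹ = K := by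
  classical
  haveI : CharZero (w.1.adicCompletion L) := charZero_of_injective_algebraMap (algebraMap L (w.1.adicCompletion L)).injective
  have h2 : (2 : w.1.adicCompletion L) ≠ 0 := two_ne_zero
  have h4 : (4 : w.1.adicCompletion L) ≠ 0 := by norm_num
  have hq0 : (Nat.card (𝓞 ↥(maximalRealSubfield L) ⧸ v.asIdeal) : ℂ) ≠ 0 := by
    have : 0 < Nat.card (𝓞 ↥(maximalRealSubfield L) ⧸ v.asIdeal) := Nat.card_pos
    exact_mod_cast this.ne'
  -- the constant `c := log|2|_w − log|η|_w` and the threshold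
  obtain ⟨cη, hcη⟩ : ∃ cη : ℤ, WithZero.log (Valued.v (2 : w.1.adicCompletion L)) - WithZero.log (Valued.v η) = cη := ⟨_, rfl⟩
  obtain ⟨Nb, hNb2, hNb4, hNbc⟩ : ∃ Nb : ℕ, (-WithZero.log (Valued.v (2 : w.1.adicCompletion L))).toNat + 1 ≤ Nb ∧
      (-WithZero.log (Valued.v (4 : w.1.adicCompletion L))).toNat + 1 ≤ Nb ∧ cη ≤ Nb :=
    ⟨max (max ((-WithZero.log (Valued.v (2 : w.1.adicCompletion L))).toNat + 1) ((-WithZero.log (Valued.v (4 : w.1.adicCompletion L))).toNat + 1)) cη.toNat,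
      le_trans (le_max_left _ _) (le_max_left _ _), le_trans (le_max_right _ _) (le_max_left _ _),
      le_trans (Int.self_le_toNat cη) (by exact_mod_cast le_max_right _ _)⟩
  -- per-point facts on the deep regular locus
  have hfacts : ∀ t : ↥(Subgroup.centralizer ({t₀} : Set ((cmDatum L 2 (Matrix.of fun i j : Fin 2 => if i.val + j.val + 1 = 2 then (1 : L) else 0)).Local v × (cmDatum L 1 (Matrix.of fun i j : Fin 1 => if i.val + j.val + 1 = 1 then (1 : L) else 0)).Local v))), IsRegularElt ((t : ((cmDatum L 2 (Matrix.of fun i j : Fin 2 => if i.val + j.val + 1 = 2 then (1 : L) else 0)).Local v × (cmDatum L 1 (Matrix.of fun i j : Fin 1 => if i.val + j.val + 1 = 1 then (1 : L) else 0)).Local v)).1.val : GL (Fin 2) (LocalRing L v)) → Nb ≤ (-WithZero.log (Valued.v ((((P⁻¹).val * ((t : ((cmDatum L 2 (Matrix.of fun i j : Fin 2 => if i.val + j.val + 1 = 2 then (1 : L) else 0)).Local v × (cmDatum L 1 (Matrix.of fun i j : Fin 1 => if i.val + j.val + 1 = 1 then (1 : L) else 0)).Local v)).1.val.val : Matrix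 (Fin 2) (Fin 2) (LocalRing L v)) * P.val) 0 0 - ((P⁻¹).val * ((t : ((cmDatum L 2 (Matrix.of fun i j : Fin 2 => if i.val + j.val + 1 = 2 then (1 : L) else 0)).Local v × (cmDatum L 1 (Matrix.of fun i j : Fin 1 => if i.val + j.val + 1 = 1 then (1 : L) else 0)).Local v)).1.val.val : Matrix (Fin 2) (Fin 2) (LocalRing L v)) * P.val) 1 1) w))).toNat →
      conjLocal L (IsCMField.complexConj L) v (((P⁻¹).val * ((t : ((cmDatum L 2 (Matrix.of fun i j : Fin 2 => if i.val + j.val + 1 = 2 then (1 : L) else 0)).Local v × (cmDatum L 1 (Matrix.of fun i j : Fin 1 => if i.val + j.val + 1 = 1 then (1 : L) else 0)).Local v)).1.val.val : Matrix (Fin 2) (Fin 2) (LocalRing L v)) * P.val) 0 0) * (((P⁻¹).val * ((t : ((cmDatum L 2 (Matrix.of fun i j : Fin 2 => if i.val + j.val + 1 = 2 then (1 : L) else 0)).Local v × (cmDatum L 1 (Matrix.of fun i j : Fin 1 => if i.val + j.val + 1 = 1 then (1 : L) else 0)).Local v)).1.val.val : Matrix (Fin 2) (Fin 2) (LocalRing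 L v)) * P.val) 0 0) = 1 ∧ conjLocal L (IsCMField.complexConj L) v (((P⁻¹).val * ((t : ((cmDatum L 2 (Matrix.of fun i j : Fin 2 => if i.val + j.val + 1 = 2 then (1 : L) else 0)).Local v × (cmDatum L 1 (Matrix.of fun i j : Fin 1 => if i.val + j.val + 1 = 1 then (1 : L) else 0)).Local v)).1.val.val : Matrix (Fin 2) (Fin 2) (LocalRing L v)) * P.val) 1 1) * (((P⁻¹).val * ((t : ((cmDatum L 2 (Matrix.of fun i j : Fin 2 => if i.val + j.val + 1 = 2 then (1 : L) else 0)).Local v × (cmDatum L 1 (Matrix.of fun i j : Fin 1 => if i.val + j.val + 1 = 1 then (1 : L) else 0)).Local v)).1.val.val : Matrix (Fin 2) (Fin 2) (LocalRing L v)) * P.val) 1 1) = 1 ∧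
      ((P⁻¹).val * ((t : ((cmDatum L 2 (Matrix.of fun i j : Fin 2 => if i.val + j.val + 1 = 2 then (1 : L) else 0)).Local v × (cmDatum L 1 (Matrix.of fun i j : Fin 1 => if i.val + j.val + 1 = 1 then (1 : L) else 0)).Local v)).1.val.val : Matrix (Fin 2) (Fin 2) (LocalRing L v)) * P.val) 0 0 w - ((P⁻¹).val * ((t : ((cmDatum L 2 (Matrix.of fun i j : Fin 2 => if i.val + j.val + 1 = 2 then (1 : L) else 0)).Local v × (cmDatum L 1 (Matrix.of fun i j : Fin 1 => if i.val + j.val + 1 = 1 then (1 : L) else 0)).Local v)).1.val.val : Matrix (Fin 2) (Fin 2) (LocalRing L v)) * P.val) 1 1 w ≠ 0 ∧ Valued.v (((P⁻¹).val * ((t : ((cmDatum L 2 (Matrix.of fun i j : Fin 2 => if i.val + j.val + 1 = 2 then (1 : L) else 0)).Local v × (cmDatum L 1 (Matrix.of fun i j : Fin 1 => if i.val + j.val + 1 = 1 then (1 : L) else 0)).Local v)).1.val.val : Matrix (Fin 2) (Fin 2) (LocalRing L v)) * P.val) 0 0 w - ((P⁻¹).val * ((t : ((cmDatum L 2 (Matrix.of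 fun i j : Fin 2 => if i.val + j.val + 1 = 2 then (1 : L) else 0)).Local v × (cmDatum L 1 (Matrix.of fun i j : Fin 1 => if i.val + j.val + 1 = 1 then (1 : L) else 0)).Local v)).1.val.val : Matrix (Fin 2) (Fin 2) (LocalRing L v)) * P.val) 1 1 w) ≤ 1 ∧
      Valued.v (((P⁻¹).val * ((t : ((cmDatum L 2 (Matrix.of fun i j : Fin 2 => if i.val + j.val + 1 = 2 then (1 : L) else 0)).Local v × (cmDatum L 1 (Matrix.of fun i j : Fin 1 => if i.val + j.val + 1 = 1 then (1 : L) else 0)).Local v)).1.val.val : Matrix (Fin 2) (Fin 2) (LocalRing L v)) * P.val) 0 0 w - ((P⁻¹).val * ((t : ((cmDatum L 2 (Matrix.of fun i j : Fin 2 => if i.val + j.val + 1 = 2 then (1 : L) else 0)).Local v × (cmDatum L 1 (Matrix.of fun i j : Fin 1 => if i.val + j.val + 1 = 1 then (1 : L) else 0)).Local v)).1.val.val : Matrix (Fin 2) (Fin 2) (LocalRing L v)) * P.val) 1 1 w) < Valued.v (2 : w.1.adicCompletion L) ∧ Valued.v (((P⁻¹).val * ((t : ((cmDatum L 2 (Matrix.of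 fun i j : Fin 2 => if i.val + j.val + 1 = 2 then (1 : L) else 0)).Local v × (cmDatum L 1 (Matrix.of fun i j : Fin 1 => if i.val + j.val + 1 = 1 then (1 : L) else 0)).Local v)).1.val.val : Matrix (Fin 2) (Fin 2) (LocalRing L v)) * P.val) 0 0 w - ((P⁻¹).val * ((t : ((cmDatum L 2 (Matrix.of fun i j : Fin 2 => if i.val + j.val + 1 = 2 then (1 : L) else 0)).Local v × (cmDatum L 1 (Matrix.of fun i j : Fin 1 => if i.val + j.val + 1 = 1 then (1 : L) else 0)).Local v)).1.val.val : Matrix (Fin 2) (Fin 2) (LocalRing L v)) * P.val) 1 1 w) < Valued.v (4 : w.1.adicCompletion L) ∧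
      ((P⁻¹).val * ((t : ((cmDatum L 2 (Matrix.of fun i j : Fin 2 => if i.val + j.val + 1 = 2 then (1 : L) else 0)).Local v × (cmDatum L 1 (Matrix.of fun i j : Fin 1 => if i.val + j.val + 1 = 1 then (1 : L) else 0)).Local v)).1.val.val : Matrix (Fin 2) (Fin 2) (LocalRing L v)) * P.val) 0 0 w ≠ ((P⁻¹).val * ((t : ((cmDatum L 2 (Matrix.of fun i j : Fin 2 => if i.val + j.val + 1 = 2 then (1 : L) else 0)).Local v × (cmDatum L 1 (Matrix.of fun i j : Fin 1 => if i.val + j.val + 1 = 1 then (1 : L) else 0)).Local v)).1.val.val : Matrix (Fin 2) (Fin 2) (LocalRing L v)) * P.val) 1 1 w ∧ ((P⁻¹).val * ((t : ((cmDatum L 2 (Matrix.of fun i j : Fin 2 => if i.val + j.val + 1 = 2 then (1 : L) else 0)).Local v × (cmDatum L 1 (Matrix.of fun i j : Fin 1 => if i.val + j.val + 1 = 1 then (1 : L) else 0)).Local v)).1.val.val : Matrix (Fin 2) (Fin 2) (LocalRing L v)) * P.val) 0 0 w ≠ -((P⁻¹).val * ((t : ((cmDatum L 2 (Matrix.of fun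 i j : Fin 2 => if i.val + j.val + 1 = 2 then (1 : L) else 0)).Local v × (cmDatum L 1 (Matrix.of fun i j : Fin 1 => if i.val + j.val + 1 = 1 then (1 : L) else 0)).Local v)).1.val.val : Matrix (Fin 2) (Fin 2) (LocalRing L v)) * P.val) 1 1 w := by
    intro t hreg hN
    have ha := conjLocal_frameEntry_mul_self_apply L v w hw t₀ P d ht₀ hP hd1 t 0
    have hc := conjLocal_frameEntry_mul_self_apply L v w hw t₀ P d ht₀ hP hd1 t 1
    have hva : Valued.v (((P⁻¹).val * ((t : ((cmDatum L 2 (Matrix.of fun i j : Fin 2 => if i.val + j.val + 1 = 2 then (1 : L) else 0)).Local v × (cmDatum L 1 (Matrix.of fun i j : Fin 1 => if i.val + j.val + 1 = 1 then (1 : L) else 0)).Local v)).1.val.val : Matrix (Fin 2) (Fin 2) (LocalRing L v)) * P.val) 0 0 w) = 1 := valued_apply_eq_one_of_conjLocal_mul_self L v w hw ha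
    have hvc : Valued.v (((P⁻¹).val * ((t : ((cmDatum L 2 (Matrix.of fun i j : Fin 2 => if i.val + j.val + 1 = 2 then (1 : L) else 0)).Local v × (cmDatum L 1 (Matrix.of fun i j : Fin 1 => if i.val + j.val + 1 = 1 then (1 : L) else 0)).Local v)).1.val.val : Matrix (Fin 2) (Fin 2) (LocalRing L v)) * P.val) 1 1 w) = 1 := valued_apply_eq_one_of_conjLocal_mul_self L v w hw hc
    have hne : ((P⁻¹).val * ((t : ((cmDatum L 2 (Matrix.of fun i j : Fin 2 => if i.val + j.val + 1 = 2 then (1 : L) else 0)).Local v × (cmDatum L 1 (Matrix.of fun i j : Fin 1 => if i.val + j.val + 1 = 1 then (1 : L) else 0)).Local v)).1.val.val : Matrix (Fin 2) (Fin 2) (LocalRing L v)) * P.val) 0 0 w ≠ ((P⁻¹).val * ((t : ((cmDatum L 2 (Matrix.of fun i j : Fin 2 => if i.val + j.val + 1 = 2 then (1 : L) else 0)).Local v × (cmDatum L 1 (Matrix.of fun i j : Fin 1 => if i.val + j.val + 1 = 1 then (1 : L) else 0)).Local v)).1.val.val : Matrix (Fin 2) (Fin 2) (LocalRing L v)) *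 P.val) 1 1 w :=
      (localRing_ne_iff_apply_ne L v w hw _ _).1 ((isRegularElt_iff_frameEntry_ne L v w hw t₀ P d ht₀ hP hd1 t).1 hreg)
    have hac : ((P⁻¹).val * ((t : ((cmDatum L 2 (Matrix.of fun i j : Fin 2 => if i.val + j.val + 1 = 2 then (1 : L) else 0)).Local v × (cmDatum L 1 (Matrix.of fun i j : Fin 1 => if i.val + j.val + 1 = 1 then (1 : L) else 0)).Local v)).1.val.val : Matrix (Fin 2) (Fin 2) (LocalRing L v)) * P.val) 0 0 w - ((P⁻¹).val * ((t : ((cmDatum L 2 (Matrix.of fun i j : Fin 2 => if i.val + j.val + 1 = 2 then (1 : L) else 0)).Local v × (cmDatum L 1 (Matrix.of fun i j : Fin 1 => if i.val + j.val + 1 = 1 then (1 : L) else 0)).Local v)).1.val.val : Matrix (Fin 2) (Fin 2) (LocalRing L v)) * P.val) 1 1 w ≠ 0 := sub_ne_zero.2 hne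
    have hle : Valued.v (((P⁻¹).val * ((t : ((cmDatum L 2 (Matrix.of fun i j : Fin 2 => if i.val + j.val + 1 = 2 then (1 : L) else 0)).Local v × (cmDatum L 1 (Matrix.of fun i j : Fin 1 => if i.val + j.val + 1 = 1 then (1 : L) else 0)).Local v)).1.val.val : Matrix (Fin 2) (Fin 2) (LocalRing L v)) * P.val) 0 0 w - ((P⁻¹).val * ((t : ((cmDatum L 2 (Matrix.of fun i j : Fin 2 => if i.val + j.val + 1 = 2 then (1 : L) else 0)).Local v × (cmDatum L 1 (Matrix.of fun i j : Fin 1 => if i.val + j.val + 1 = 1 then (1 : L) else 0)).Local v)).1.val.val : Matrix (Fin 2) (Fin 2) (LocalRing L v)) * P.val) 1 1 w) ≤ 1 := by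
      refine (Valuation.map_sub _ _ _).trans ?_
      rw [hva, hvc, max_self]
    have hNdef : (((P⁻¹).val * ((t : ((cmDatum L 2 (Matrix.of fun i j : Fin 2 => if i.val + j.val + 1 = 2 then (1 : L) else 0)).Local v × (cmDatum L 1 (Matrix.of fun i j : Fin 1 => if i.val + j.val + 1 = 1 then (1 : L) else 0)).Local v)).1.val.val : Matrix (Fin 2) (Fin 2) (LocalRing L v)) * P.val) 0 0 - ((P⁻¹).val * ((t : ((cmDatum L 2 (Matrix.of fun i j : Fin 2 => if i.val + j.val + 1 = 2 then (1 : L) else 0)).Local v × (cmDatum L 1 (Matrix.of fun i j : Fin 1 => if i.val + j.val + 1 = 1 then (1 : L) else 0)).Local v)).1.val.val : Matrix (Fin 2) (Fin 2) (LocalRing L v)) * P.val) 1 1) w = ((P⁻¹).val * ((t : ((cmDatum L 2 (Matrix.of fun i j : Fin 2 => if i.val + j.val + 1 = 2 then (1 : L) else 0)).Local v × (cmDatum L 1 (Matrix.of fun i j : Fin 1 => if i.val + j.val + 1 = 1 then (1 : L) else 0)).Local v)).1.val.val : Matrix (Fin 2) (Fin 2) (LocalRing L v)) * P.val) 0 0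 w - ((P⁻¹).val * ((t : ((cmDatum L 2 (Matrix.of fun i j : Fin 2 => if i.val + j.val + 1 = 2 then (1 : L) else 0)).Local v × (cmDatum L 1 (Matrix.of fun i j : Fin 1 => if i.val + j.val + 1 = 1 then (1 : L) else 0)).Local v)).1.val.val : Matrix (Fin 2) (Fin 2) (LocalRing L v)) * P.val) 1 1 w := Pi.sub_apply _ _ _
    rw [hNdef] at hN
    have hlt2 : Valued.v (((P⁻¹).val * ((t : ((cmDatum L 2 (Matrix.of fun i j : Fin 2 => if i.val + j.val + 1 = 2 then (1 : L) else 0)).Local v × (cmDatum L 1 (Matrix.of fun i j : Fin 1 => if i.val + j.val + 1 = 1 then (1 : L) else 0)).Local v)).1.val.val : Matrix (Fin 2) (Fin 2) (LocalRing L v)) * P.val) 0 0 w - ((P⁻¹).val * ((t : ((cmDatum L 2 (Matrix.of fun i j : Fin 2 => if i.val + j.val + 1 = 2 then (1 : L) else 0)).Local v × (cmDatum L 1 (Matrix.of fun i j : Fin 1 => if i.val + j.val + 1 = 1 then (1 : L) else 0)).Local v)).1.val.val : Matrix (Fin 2) (Fin 2) (LocalRing L v)) * P.val) 1 1 w) <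 Valued.v (2 : w.1.adicCompletion L) := valued_lt_of_toNat_succ_le hac hle h2 (le_trans hNb2 hN)
    have hlt4 : Valued.v (((P⁻¹).val * ((t : ((cmDatum L 2 (Matrix.of fun i j : Fin 2 => if i.val + j.val + 1 = 2 then (1 : L) else 0)).Local v × (cmDatum L 1 (Matrix.of fun i j : Fin 1 => if i.val + j.val + 1 = 1 then (1 : L) else 0)).Local v)).1.val.val : Matrix (Fin 2) (Fin 2) (LocalRing L v)) * P.val) 0 0 w - ((P⁻¹).val * ((t : ((cmDatum L 2 (Matrix.of fun i j : Fin 2 => if i.val + j.val + 1 = 2 then (1 : L) else 0)).Local v × (cmDatum L 1 (Matrix.of fun i j : Fin 1 => if i.val + j.val + 1 = 1 then (1 : L) else 0)).Local v)).1.val.val : Matrix (Fin 2) (Fin 2) (LocalRing L v)) * P.val) 1 1 w) < Valued.v (4 : w.1.adicCompletion L) := valued_lt_of_toNat_succ_le hac hle h4 (le_trans hNb4 hN)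
    have hne' : ((P⁻¹).val * ((t : ((cmDatum L 2 (Matrix.of fun i j : Fin 2 => if i.val + j.val + 1 = 2 then (1 : L) else 0)).Local v × (cmDatum L 1 (Matrix.of fun i j : Fin 1 => if i.val + j.val + 1 = 1 then (1 : L) else 0)).Local v)).1.val.val : Matrix (Fin 2) (Fin 2) (LocalRing L v)) * P.val) 0 0 w ≠ -((P⁻¹).val * ((t : ((cmDatum L 2 (Matrix.of fun i j : Fin 2 => if i.val + j.val + 1 = 2 then (1 : L) else 0)).Local v × (cmDatum L 1 (Matrix.of fun i j : Fin 1 => if i.val + j.val + 1 = 1 then (1 : L) else 0)).Local v)).1.val.val : Matrix (Fin 2) (Fin 2) (LocalRing L v)) * P.val) 1 1 w := by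
      intro h
      have h' : ((P⁻¹).val * ((t : ((cmDatum L 2 (Matrix.of fun i j : Fin 2 => if i.val + j.val + 1 = 2 then (1 : L) else 0)).Local v × (cmDatum L 1 (Matrix.of fun i j : Fin 1 => if i.val + j.val + 1 = 1 then (1 : L) else 0)).Local v)).1.val.val : Matrix (Fin 2) (Fin 2) (LocalRing L v)) * P.val) 0 0 w - ((P⁻¹).val * ((t : ((cmDatum L 2 (Matrix.of fun i j : Fin 2 => if i.val + j.val + 1 = 2 then (1 : L) else 0)).Local v × (cmDatum L 1 (Matrix.of fun i j : Fin 1 => if i.val + j.val + 1 = 1 then (1 : L) else 0)).Local v)).1.val.val : Matrix (Fin 2) (Fin 2) (LocalRing L v)) * P.val) 1 1 w = -(2 * ((P⁻¹).val * ((t : ((cmDatum L 2 (Matrix.of fun i j : Fin 2 => if i.val + j.val + 1 = 2 then (1 : L) else 0)).Local v × (cmDatum L 1 (Matrix.of fun i j : Fin 1 => if i.val + j.val + 1 = 1 then (1 : L) else 0)).Local v)).1.val.val : Matrix (Fin 2) (Fin 2) (LocalRing L v)) * P.val) 1 1 w) := by rw [h]; ring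
      rw [h', Valuation.map_neg, Valuation.map_mul, hvc, mul_one] at hlt2
      exact lt_irrefl _ hlt2
    exact ⟨ha, hc, hac, hle, hlt2, hlt4, hne, hne'⟩
  -- the coordinate functions, chosen on the deep regular locus (junk `1` elsewhere)
  have hex : ∀ t : ↥(Subgroup.centralizer ({t₀} : Set ((cmDatum L 2 (Matrix.of fun i j : Fin 2 => if i.val + j.val + 1 = 2 then (1 : L) else 0)).Local v × (cmDatum L 1 (Matrix.of fun i j : Fin 1 => if i.val + j.val + 1 = 1 then (1 : L) else 0)).Local v))), IsRegularElt ((t : ((cmDatum L 2 (Matrix.of fun i j : Fin 2 => if i.val + j.val + 1 = 2 then (1 : L) else 0)).Local v × (cmDatum L 1 (Matrix.of fun i j : Fin 1 => if i.val + j.val + 1 = 1 then (1 : L) else 0)).Local v)).1.val : GL (Fin 2) (LocalRing L v)) → Nb ≤ (-WithZero.log (Valued.v ((((P⁻¹).val * ((t : ((cmDatum L 2 (Matrix.of fun i j : Fin 2 => if i.val + j.val + 1 = 2 then (1 : L) else 0)).Local v × (cmDatum L 1 (Matrix.of fun i j : Fin 1 => if i.val + j.val + 1 = 1 then (1 : L)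 else 0)).Local v)).1.val.val : Matrix (Fin 2) (Fin 2) (LocalRing L v)) * P.val) 0 0 - ((P⁻¹).val * ((t : ((cmDatum L 2 (Matrix.of fun i j : Fin 2 => if i.val + j.val + 1 = 2 then (1 : L) else 0)).Local v × (cmDatum L 1 (Matrix.of fun i j : Fin 1 => if i.val + j.val + 1 = 1 then (1 : L) else 0)).Local v)).1.val.val : Matrix (Fin 2) (Fin 2) (LocalRing L v)) * P.val) 1 1) w))).toNat → ∃ p : (v.adicCompletion ↥(maximalRealSubfield L))ˣ × (v.adicCompletion ↥(maximalRealSubfield L))ˣ × (v.adicCompletion ↥(maximalRealSubfield L))ˣ,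
      toPlace v w ((p.1 : (v.adicCompletion ↥(maximalRealSubfield L))ˣ) : v.adicCompletion ↥(maximalRealSubfield L)) = (((P⁻¹).val * ((t : ((cmDatum L 2 (Matrix.of fun i j : Fin 2 => if i.val + j.val + 1 = 2 then (1 : L) else 0)).Local v × (cmDatum L 1 (Matrix.of fun i j : Fin 1 => if i.val + j.val + 1 = 1 then (1 : L) else 0)).Local v)).1.val.val : Matrix (Fin 2) (Fin 2) (LocalRing L v)) * P.val) 0 0 w / ((P⁻¹).val * ((t : ((cmDatum L 2 (Matrix.of fun i j : Fin 2 => if i.val + j.val + 1 = 2 then (1 : L) else 0)).Local v × (cmDatum L 1 (Matrix.of fun i j : Fin 1 => if i.val + j.val + 1 = 1 then (1 : L) else 0)).Local v)).1.val.val : Matrix (Fin 2) (Fin 2) (LocalRing L v)) * P.val) 1 1 w - 1) / ((((P⁻¹).val * ((t : ((cmDatum L 2 (Matrix.of fun i j : Fin 2 => if i.val + j.val + 1 = 2 then (1 : L) else 0)).Local v × (cmDatum L 1 (Matrix.of fun i j : Fin 1 => if i.val + j.val + 1 = 1 then (1 : L) else 0)).Local v)).1.val.val : Matrix (Fin 2)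 (Fin 2) (LocalRing L v)) * P.val) 0 0 w / ((P⁻¹).val * ((t : ((cmDatum L 2 (Matrix.of fun i j : Fin 2 => if i.val + j.val + 1 = 2 then (1 : L) else 0)).Local v × (cmDatum L 1 (Matrix.of fun i j : Fin 1 => if i.val + j.val + 1 = 1 then (1 : L) else 0)).Local v)).1.val.val : Matrix (Fin 2) (Fin 2) (LocalRing L v)) * P.val) 1 1 w + 1) * η) ∧
      toPlace v w ((p.2.1 : (v.adicCompletion ↥(maximalRealSubfield L))ˣ) : v.adicCompletion ↥(maximalRealSubfield L)) = (((P⁻¹).val * ((t : ((cmDatum L 2 (Matrix.of fun i j : Fin 2 => if i.val + j.val + 1 = 2 then (1 : L) else 0)).Local v × (cmDatum L 1 (Matrix.of fun i j : Fin 1 => if i.val + j.val + 1 = 1 then (1 : L) else 0)).Local v)).1.val.val : Matrix (Fin 2) (Fin 2) (LocalRing L v)) * P.val) 0 0 w / ((P⁻¹).val * ((t : ((cmDatum L 2 (Matrix.of fun i j : Fin 2 => if i.val + j.val + 1 = 2 then (1 : L) else 0)).Local v × (cmDatum L 1 (Matrix.of fun i j : Fin 1 => if i.val + j.val + 1 =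 1 then (1 : L) else 0)).Local v)).1.val.val : Matrix (Fin 2) (Fin 2) (LocalRing L v)) * P.val) 1 1 w - ((P⁻¹).val * ((t : ((cmDatum L 2 (Matrix.of fun i j : Fin 2 => if i.val + j.val + 1 = 2 then (1 : L) else 0)).Local v × (cmDatum L 1 (Matrix.of fun i j : Fin 1 => if i.val + j.val + 1 = 1 then (1 : L) else 0)).Local v)).1.val.val : Matrix (Fin 2) (Fin 2) (LocalRing L v)) * P.val) 1 1 w / ((P⁻¹).val * ((t : ((cmDatum L 2 (Matrix.of fun i j : Fin 2 => if i.val + j.val + 1 = 2 then (1 : L) else 0)).Local v × (cmDatum L 1 (Matrix.of fun i j : Fin 1 => if i.val + j.val + 1 = 1 then (1 : L) else 0)).Local v)).1.val.val : Matrix (Fin 2) (Fin 2) (LocalRing L v)) * P.val) 0 0 w) / η ∧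
      toPlace v w ((p.2.2 : (v.adicCompletion ↥(maximalRealSubfield L))ˣ) : v.adicCompletion ↥(maximalRealSubfield L)) = ((P⁻¹).val * ((t : ((cmDatum L 2 (Matrix.of fun i j : Fin 2 => if i.val + j.val + 1 = 2 then (1 : L) else 0)).Local v × (cmDatum L 1 (Matrix.of fun i j : Fin 1 => if i.val + j.val + 1 = 1 then (1 : L) else 0)).Local v)).1.val.val : Matrix (Fin 2) (Fin 2) (LocalRing L v)) * P.val) 0 0 w / ((P⁻¹).val * ((t : ((cmDatum L 2 (Matrix.of fun i j : Fin 2 => if i.val + j.val + 1 = 2 then (1 : L) else 0)).Local v × (cmDatum L 1 (Matrix.of fun i j : Fin 1 => if i.val + j.val + 1 = 1 then (1 : L) else 0)).Local v)).1.val.val : Matrix (Fin 2) (Fin 2) (LocalRing L v)) * P.val) 1 1 w + ((P⁻¹).val * ((t : ((cmDatum L 2 (Matrix.of fun i j : Fin 2 => if i.val + j.val + 1 = 2 then (1 : L) else 0)).Local v × (cmDatum L 1 (Matrix.of fun i j : Fin 1 => if i.val + j.val + 1 = 1 then (1 : L) else 0)).Local v)).1.val.val : Matrix (Fin 2) (Fin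 2) (LocalRing L v)) * P.val) 1 1 w / ((P⁻¹).val * ((t : ((cmDatum L 2 (Matrix.of fun i j : Fin 2 => if i.val + j.val + 1 = 2 then (1 : L) else 0)).Local v × (cmDatum L 1 (Matrix.of fun i j : Fin 1 => if i.val + j.val + 1 = 1 then (1 : L) else 0)).Local v)).1.val.val : Matrix (Fin 2) (Fin 2) (LocalRing L v)) * P.val) 0 0 w + 2 := fun t hreg hN =>
    exists_units_coords L v w hw hση hη0 (hfacts t hreg hN).1 (hfacts t hreg hN).2.1 (hfacts t hreg hN).2.2.2.2.2.2.1 (hfacts t hreg hN).2.2.2.2.2.2.2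
  let F : ↥(Subgroup.centralizer ({t₀} : Set ((cmDatum L 2 (Matrix.of fun i j : Fin 2 => if i.val + j.val + 1 = 2 then (1 : L) else 0)).Local v × (cmDatum L 1 (Matrix.of fun i j : Fin 1 => if i.val + j.val + 1 = 1 then (1 : L) else 0)).Local v))) → (v.adicCompletion ↥(maximalRealSubfield L))ˣ × (v.adicCompletion ↥(maximalRealSubfield L))ˣ × (v.adicCompletion ↥(maximalRealSubfield L))ˣ := fun t => if h : IsRegularElt ((t : ((cmDatum L 2 (Matrix.of fun i j : Fin 2 => if i.val + j.val + 1 = 2 then (1 : L) else 0)).Local v × (cmDatum L 1 (Matrix.of fun i j : Fin 1 => if i.val + j.val + 1 = 1 then (1 : L) else 0)).Local v)).1.val : GL (Fin 2) (LocalRing L v)) ∧ Nb ≤ (-WithZero.log (Valued.v ((((P⁻¹).val * ((t : ((cmDatum L 2 (Matrix.of fun i j : Fin 2 => if i.val + j.val + 1 = 2 then (1 : L) else 0)).Local v × (cmDatum L 1 (Matrix.of fun i j : Fin 1 => if i.val + j.val + 1 = 1 then (1 : L) else 0)).Local v)).1.val.val : Matrix (Fin 2) (Fin 2) (LocalRing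 L v)) * P.val) 0 0 - ((P⁻¹).val * ((t : ((cmDatum L 2 (Matrix.of fun i j : Fin 2 => if i.val + j.val + 1 = 2 then (1 : L) else 0)).Local v × (cmDatum L 1 (Matrix.of fun i j : Fin 1 => if i.val + j.val + 1 = 1 then (1 : L) else 0)).Local v)).1.val.val : Matrix (Fin 2) (Fin 2) (LocalRing L v)) * P.val) 1 1) w))).toNat then Classical.choose (hex t h.1 h.2) else (1, 1, 1)
  have hF : ∀ t : ↥(Subgroup.centralizer ({t₀} : Set ((cmDatum L 2 (Matrix.of fun i j : Fin 2 => if i.val + j.val + 1 = 2 then (1 : L) else 0)).Local v × (cmDatum L 1 (Matrix.of fun i j : Fin 1 => if i.val + j.val + 1 = 1 then (1 : L) else 0)).Local v))), IsRegularElt ((t : ((cmDatum L 2 (Matrix.of fun i j : Fin 2 => if i.val + j.val + 1 = 2 then (1 : L) else 0)).Local v × (cmDatum L 1 (Matrix.of fun i j : Fin 1 => if i.val + j.val + 1 = 1 then (1 : L) else 0)).Local v)).1.val : GL (Fin 2) (LocalRing L v)) → Nb ≤ (-WithZero.log (Valued.v ((((P⁻¹).val * ((t : ((cmDatum L 2 (Matrix.of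 fun i j : Fin 2 => if i.val + j.val + 1 = 2 then (1 : L) else 0)).Local v × (cmDatum L 1 (Matrix.of fun i j : Fin 1 => if i.val + j.val + 1 = 1 then (1 : L) else 0)).Local v)).1.val.val : Matrix (Fin 2) (Fin 2) (LocalRing L v)) * P.val) 0 0 - ((P⁻¹).val * ((t : ((cmDatum L 2 (Matrix.of fun i j : Fin 2 => if i.val + j.val + 1 = 2 then (1 : L) else 0)).Local v × (cmDatum L 1 (Matrix.of fun i j : Fin 1 => if i.val + j.val + 1 = 1 then (1 : L) else 0)).Local v)).1.val.val : Matrix (Fin 2) (Fin 2) (LocalRing L v)) * P.val) 1 1) w))).toNat →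
      toPlace v w (((F t).1 : (v.adicCompletion ↥(maximalRealSubfield L))ˣ) : v.adicCompletion ↥(maximalRealSubfield L)) = (((P⁻¹).val * ((t : ((cmDatum L 2 (Matrix.of fun i j : Fin 2 => if i.val + j.val + 1 = 2 then (1 : L) else 0)).Local v × (cmDatum L 1 (Matrix.of fun i j : Fin 1 => if i.val + j.val + 1 = 1 then (1 : L) else 0)).Local v)).1.val.val : Matrix (Fin 2) (Fin 2) (LocalRing L v)) * P.val) 0 0 w / ((P⁻¹).val * ((t : ((cmDatum L 2 (Matrix.of fun i j : Fin 2 => if i.val + j.val + 1 = 2 then (1 : L) else 0)).Local v × (cmDatum L 1 (Matrix.of fun i j : Fin 1 => if i.val + j.val + 1 = 1 then (1 : L) else 0)).Local v)).1.val.val : Matrix (Fin 2) (Fin 2) (LocalRing L v)) * P.val) 1 1 w - 1) / ((((P⁻¹).val * ((t : ((cmDatum L 2 (Matrix.of fun i j : Fin 2 => if i.val + j.val + 1 = 2 then (1 : L) else 0)).Local v × (cmDatum L 1 (Matrix.of fun i j : Fin 1 => if i.val + j.val + 1 = 1 then (1 : L) else 0)).Local v)).1.val.val : Matrix (Fin 2)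 (Fin 2) (LocalRing L v)) * P.val) 0 0 w / ((P⁻¹).val * ((t : ((cmDatum L 2 (Matrix.of fun i j : Fin 2 => if i.val + j.val + 1 = 2 then (1 : L) else 0)).Local v × (cmDatum L 1 (Matrix.of fun i j : Fin 1 => if i.val + j.val + 1 = 1 then (1 : L) else 0)).Local v)).1.val.val : Matrix (Fin 2) (Fin 2) (LocalRing L v)) * P.val) 1 1 w + 1) * η) ∧
      toPlace v w (((F t).2.1 : (v.adicCompletion ↥(maximalRealSubfield L))ˣ) : v.adicCompletion ↥(maximalRealSubfield L)) = (((P⁻¹).val * ((t : ((cmDatum L 2 (Matrix.of fun i j : Fin 2 => if i.val + j.val + 1 = 2 then (1 : L) else 0)).Local v × (cmDatum L 1 (Matrix.of fun i j : Fin 1 => if i.val + j.val + 1 = 1 then (1 : L) else 0)).Local v)).1.val.val : Matrix (Fin 2) (Fin 2) (LocalRing L v)) * P.val) 0 0 w / ((P⁻¹).val * ((t : ((cmDatum L 2 (Matrix.of fun i j : Fin 2 => if i.val + j.val + 1 = 2 then (1 : L) else 0)).Local v × (cmDatum L 1 (Matrix.of fun i j : Fin 1 => if i.val + j.val + 1 =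 1 then (1 : L) else 0)).Local v)).1.val.val : Matrix (Fin 2) (Fin 2) (LocalRing L v)) * P.val) 1 1 w - ((P⁻¹).val * ((t : ((cmDatum L 2 (Matrix.of fun i j : Fin 2 => if i.val + j.val + 1 = 2 then (1 : L) else 0)).Local v × (cmDatum L 1 (Matrix.of fun i j : Fin 1 => if i.val + j.val + 1 = 1 then (1 : L) else 0)).Local v)).1.val.val : Matrix (Fin 2) (Fin 2) (LocalRing L v)) * P.val) 1 1 w / ((P⁻¹).val * ((t : ((cmDatum L 2 (Matrix.of fun i j : Fin 2 => if i.val + j.val + 1 = 2 then (1 : L) else 0)).Local v × (cmDatum L 1 (Matrix.of fun i j : Fin 1 => if i.val + j.val + 1 = 1 then (1 : L) else 0)).Local v)).1.val.val : Matrix (Fin 2) (Fin 2) (LocalRing L v)) * P.val) 0 0 w) / η ∧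
      toPlace v w (((F t).2.2 : (v.adicCompletion ↥(maximalRealSubfield L))ˣ) : v.adicCompletion ↥(maximalRealSubfield L)) = ((P⁻¹).val * ((t : ((cmDatum L 2 (Matrix.of fun i j : Fin 2 => if i.val + j.val + 1 = 2 then (1 : L) else 0)).Local v × (cmDatum L 1 (Matrix.of fun i j : Fin 1 => if i.val + j.val + 1 = 1 then (1 : L) else 0)).Local v)).1.val.val : Matrix (Fin 2) (Fin 2) (LocalRing L v)) * P.val) 0 0 w / ((P⁻¹).val * ((t : ((cmDatum L 2 (Matrix.of fun i j : Fin 2 => if i.val + j.val + 1 = 2 then (1 : L) else 0)).Local v × (cmDatum L 1 (Matrix.of fun i j : Fin 1 => if i.val + j.val + 1 = 1 then (1 : L) else 0)).Local v)).1.val.val : Matrix (Fin 2) (Fin 2) (LocalRing L v)) * P.val) 1 1 w + ((P⁻¹).val * ((t : ((cmDatum L 2 (Matrix.of fun i j : Fin 2 => if i.val + j.val + 1 = 2 then (1 : L) else 0)).Local v × (cmDatum L 1 (Matrix.of fun i j : Fin 1 => if i.val + j.val + 1 = 1 then (1 : L) else 0)).Local v)).1.val.val : Matrix (Fin 2) (Fin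 2) (LocalRing L v)) * P.val) 1 1 w / ((P⁻¹).val * ((t : ((cmDatum L 2 (Matrix.of fun i j : Fin 2 => if i.val + j.val + 1 = 2 then (1 : L) else 0)).Local v × (cmDatum L 1 (Matrix.of fun i j : Fin 1 => if i.val + j.val + 1 = 1 then (1 : L) else 0)).Local v)).1.val.val : Matrix (Fin 2) (Fin 2) (LocalRing L v)) * P.val) 0 0 w + 2 := by
    intro t hreg hN
    have hFt : F t = Classical.choose (hex t hreg hN) := dif_pos ⟨hreg, hN⟩
    rw [hFt]
    exact Classical.choose_spec (hex t hreg hN)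
  refine ⟨Nb, fun t => (F t).1, fun t => (F t).2.1, fun t => (F t).2.2, (Nat.card (𝓞 ↥(maximalRealSubfield L) ⧸ v.asIdeal) : ℂ) ^ (-((cη - 1) / 2)), zpow_ne_zero _ hq0, hF, fun t hreg hN => ?_⟩
  obtain ⟨ha, hc, hac, hle, hlt2, hlt4, hne, hne'⟩ := hfacts t hreg hN
  obtain ⟨hb₀, hbc, htc⟩ := hF t hreg hN
  -- SIGN: the first two factors multiply to `1`
  rw [cast_hilbertSymbol_mul_cast_hilbertSymbol_bcoord_eq_one L v w hw ha hc hlt4 hne' hb₀ hbc htc, one_mul]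
  -- EXPONENT: `N = 2·ord_v bc + c`
  have hlog := two_mul_log_valued_bcoord_eq L v w hw he hη0 ha hc hlt2 hac hbc
  have hNdef : (((P⁻¹).val * ((t : ((cmDatum L 2 (Matrix.of fun i j : Fin 2 => if i.val + j.val + 1 = 2 then (1 : L) else 0)).Local v × (cmDatum L 1 (Matrix.of fun i j : Fin 1 => if i.val + j.val + 1 = 1 then (1 : L) else 0)).Local v)).1.val.val : Matrix (Fin 2) (Fin 2) (LocalRing L v)) * P.val) 0 0 - ((P⁻¹).val * ((t : ((cmDatum L 2 (Matrix.of fun i j : Fin 2 => if i.val + j.val + 1 = 2 then (1 : L) else 0)).Local v × (cmDatum L 1 (Matrix.of fun i j : Fin 1 => if i.val + j.val + 1 = 1 then (1 : L) else 0)).Local v)).1.val.val : Matrix (Fin 2) (Fin 2) (LocalRing L v)) * P.val) 1 1) w = ((P⁻¹).val * ((t : ((cmDatum L 2 (Matrix.of fun i j : Fin 2 => if i.val + j.val + 1 = 2 then (1 : L) else 0)).Local v × (cmDatum L 1 (Matrix.of fun i j : Fin 1 => if i.val + j.val + 1 = 1 then (1 : L) else 0)).Local v)).1.val.val : Matrix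 (Fin 2) (Fin 2) (LocalRing L v)) * P.val) 0 0 w - ((P⁻¹).val * ((t : ((cmDatum L 2 (Matrix.of fun i j : Fin 2 => if i.val + j.val + 1 = 2 then (1 : L) else 0)).Local v × (cmDatum L 1 (Matrix.of fun i j : Fin 1 => if i.val + j.val + 1 = 1 then (1 : L) else 0)).Local v)).1.val.val : Matrix (Fin 2) (Fin 2) (LocalRing L v)) * P.val) 1 1 w := Pi.sub_apply _ _ _
  have hNZ : (((-WithZero.log (Valued.v ((((P⁻¹).val * ((t : ((cmDatum L 2 (Matrix.of fun i j : Fin 2 => if i.val + j.val + 1 = 2 then (1 : L) else 0)).Local v × (cmDatum L 1 (Matrix.of fun i j : Fin 1 => if i.val + j.val + 1 = 1 then (1 : L) else 0)).Local v)).1.val.val : Matrix (Fin 2) (Fin 2) (LocalRing L v)) * P.val) 0 0 - ((P⁻¹).val * ((t : ((cmDatum L 2 (Matrix.of fun i j : Fin 2 => if i.val + j.val + 1 = 2 then (1 : L) else 0)).Local v × (cmDatum L 1 (Matrix.of fun i j : Fin 1 => if i.val + j.val + 1 = 1 then (1 : L) else 0)).Local v)).1.val.val : Matrix (Fin 2)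 (Fin 2) (LocalRing L v)) * P.val) 1 1) w))).toNat : ℕ) : ℤ) = -WithZero.log (Valued.v (((P⁻¹).val * ((t : ((cmDatum L 2 (Matrix.of fun i j : Fin 2 => if i.val + j.val + 1 = 2 then (1 : L) else 0)).Local v × (cmDatum L 1 (Matrix.of fun i j : Fin 1 => if i.val + j.val + 1 = 1 then (1 : L) else 0)).Local v)).1.val.val : Matrix (Fin 2) (Fin 2) (LocalRing L v)) * P.val) 0 0 w - ((P⁻¹).val * ((t : ((cmDatum L 2 (Matrix.of fun i j : Fin 2 => if i.val + j.val + 1 = 2 then (1 : L) else 0)).Local v × (cmDatum L 1 (Matrix.of fun i j : Fin 1 => if i.val + j.val + 1 = 1 then (1 : L) else 0)).Local v)).1.val.val : Matrix (Fin 2) (Fin 2) (LocalRing L v)) * P.val) 1 1 w)) := by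
    rw [hNdef]; exact natCast_toNat_neg_log_eq hac hle
  have hNZ' := hNZ
  rw [hNdef] at hN hNZ'
  have hcle : cη ≤ (((-WithZero.log (Valued.v (((P⁻¹).val * ((t : ((cmDatum L 2 (Matrix.of fun i j : Fin 2 => if i.val + j.val + 1 = 2 then (1 : L) else 0)).Local v × (cmDatum L 1 (Matrix.of fun i j : Fin 1 => if i.val + j.val + 1 = 1 then (1 : L) else 0)).Local v)).1.val.val : Matrix (Fin 2) (Fin 2) (LocalRing L v)) * P.val) 0 0 w - ((P⁻¹).val * ((t : ((cmDatum L 2 (Matrix.of fun i j : Fin 2 => if i.val + j.val + 1 = 2 then (1 : L) else 0)).Local v × (cmDatum L 1 (Matrix.of fun i j : Fin 1 => if i.val + j.val + 1 = 1 then (1 : L) else 0)).Local v)).1.val.val : Matrix (Fin 2) (Fin 2) (LocalRing L v)) * P.val) 1 1 w))).toNat : ℕ) : ℤ) := le_trans hNbc (by exact_mod_cast hN)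
  have hoZ : (((-WithZero.log (Valued.v (((F t).2.1 : (v.adicCompletion ↥(maximalRealSubfield L))ˣ) : v.adicCompletion ↥(maximalRealSubfield L)))).toNat : ℕ) : ℤ) = -WithZero.log (Valued.v (((F t).2.1 : (v.adicCompletion ↥(maximalRealSubfield L))ˣ) : v.adicCompletion ↥(maximalRealSubfield L))) :=
    Int.toNat_of_nonneg (by omega)
  have hNo : (((-WithZero.log (Valued.v ((((P⁻¹).val * ((t : ((cmDatum L 2 (Matrix.of fun i j : Fin 2 => if i.val + j.val + 1 = 2 then (1 : L) else 0)).Local v × (cmDatum L 1 (Matrix.of fun i j : Fin 1 => if i.val + j.val + 1 = 1 then (1 : L) else 0)).Local v)).1.val.val : Matrix (Fin 2) (Fin 2) (LocalRing L v)) * P.val) 0 0 - ((P⁻¹).val * ((t : ((cmDatum L 2 (Matrix.of fun i j : Fin 2 => if i.val + j.val + 1 = 2 then (1 : L) else 0)).Local v × (cmDatum L 1 (Matrix.of fun i j : Fin 1 => if i.val + j.val + 1 = 1 then (1 : L) else 0)).Local v)).1.val.val : Matrix (Fin 2) (Fin 2) (LocalRing L v)) * P.val) 1 1) w))).toNat :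 ℕ) : ℤ) = 2 * (((-WithZero.log (Valued.v (((F t).2.1 : (v.adicCompletion ↥(maximalRealSubfield L))ˣ) : v.adicCompletion ↥(maximalRealSubfield L)))).toNat : ℕ) : ℤ) + cη := by
    rw [hNZ, hoZ]; omega
  have hN1 : 1 ≤ (-WithZero.log (Valued.v ((((P⁻¹).val * ((t : ((cmDatum L 2 (Matrix.of fun i j : Fin 2 => if i.val + j.val + 1 = 2 then (1 : L) else 0)).Local v × (cmDatum L 1 (Matrix.of fun i j : Fin 1 => if i.val + j.val + 1 = 1 then (1 : L) else 0)).Local v)).1.val.val : Matrix (Fin 2) (Fin 2) (LocalRing L v)) * P.val) 0 0 - ((P⁻¹).val * ((t : ((cmDatum L 2 (Matrix.of fun i j : Fin 2 => if i.val + j.val + 1 = 2 then (1 : L) else 0)).Local v × (cmDatum L 1 (Matrix.of fun i j : Fin 1 => if i.val + j.val + 1 = 1 then (1 : L) else 0)).Local v)).1.val.val : Matrix (Fin 2) (Fin 2) (LocalRing L v)) * P.val) 1 1) w))).toNat := le_trans (le_trans (Nat.le_add_left 1 _) hNb2) (by rw [hNdef]; exact hN)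
  exact pow_mul_inv_pow_half_eq_zpow hq0 hNo hN1

-- `L_w`-sized statement: elaboration budget only (no search)
set_option maxHeartbeats 1600000 in
/-- **THE (γ) LAYER'S `(book, hbook, hbookU)` LITERALLY** (★-to-be `rankOneUnstable_core_of_shellWindow`, F0P3a-p04 (g14); architect A-44): with `ε t := (b₀ t, θ)_v`,
`κβ t := (bc t, θ)_v`, `oβ t := ord_v(bc t)` (`= (−log|bc t|_v).toNat`) for the exported coordinate functions, `book := fun _ => K` is CONSTANT: `hbook` holds trivially and
`hbookU` on `U ∩ {N ≥ Nb}` (take the layer's `m₀ ≥ Nb`). [cite: LabesseLanglands1979, §2 (2.2) p. 9] [cite: Labesse2024StabilisationGermesSL2, Th. 0.0.12]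
[cite: Rogawski1990, §4.9 Lemma 4.9.3 (4.9.2) p. 56] -/
theorem exists_book_of_ramified {η : w.1.adicCompletion L} (hση : galAdicCompletionMap (L := L) (IsCMField.complexConj L) hw η = -η) (hη0 : η ≠ 0) :
    ∃ (Nb : ℕ) (b₀ bc tc : ↥(Subgroup.centralizer ({t₀} : Set ((cmDatum L 2 (Matrix.of fun i j : Fin 2 => if i.val + j.val + 1 = 2 then (1 : L) else 0)).Local v × (cmDatum L 1 (Matrix.of fun i j : Fin 1 => if i.val + j.val + 1 = 1 then (1 : L) else 0)).Local v))) → (v.adicCompletion ↥(maximalRealSubfield L))ˣ) (book : ↥(Subgroup.centralizer ({t₀} : Set ((cmDatum L 2 (Matrix.of fun i j : Fin 2 => if i.val + j.val + 1 = 2 then (1 : L) else 0)).Local v × (cmDatum L 1 (Matrix.of fun i j : Fin 1 => if i.val + j.val + 1 = 1 then (1 : L) else 0)).Local v))) → ℂ),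
      (∀ t : ↥(Subgroup.centralizer ({t₀} : Set ((cmDatum L 2 (Matrix.of fun i j : Fin 2 => if i.val + j.val + 1 = 2 then (1 : L) else 0)).Local v × (cmDatum L 1 (Matrix.of fun i j : Fin 1 => if i.val + j.val + 1 = 1 then (1 : L) else 0)).Local v))), t ∈ {t : ↥(Subgroup.centralizer ({t₀} : Set ((cmDatum L 2 (Matrix.of fun i j : Fin 2 => if i.val + j.val + 1 = 2 then (1 : L) else 0)).Local v × (cmDatum L 1 (Matrix.of fun i j : Fin 1 => if i.val + j.val + 1 = 1 then (1 : L) else 0)).Local v))) | IsRegularElt ((t : ((cmDatum L 2 (Matrix.of fun i j : Fin 2 => if i.val + j.val + 1 = 2 then (1 : L) else 0)).Local v × (cmDatum L 1 (Matrix.of fun i j : Fin 1 => if i.val + j.val + 1 = 1 then (1 : L) else 0)).Local v)).1.val : GL (Fin 2) (LocalRing L v))} → Nb ≤ (-WithZero.log (Valued.v ((((P⁻¹).val * ((t : ((cmDatum L 2 (Matrix.of fun i j : Fin 2 => if i.val + j.val + 1 = 2 then (1 : L) else 0)).Local v × (cmDatum L 1 (Matrix.of fun i j : Fin 1 => if i.val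 + j.val + 1 = 1 then (1 : L) else 0)).Local v)).1.val.val : Matrix (Fin 2) (Fin 2) (LocalRing L v)) * P.val) 0 0 - ((P⁻¹).val * ((t : ((cmDatum L 2 (Matrix.of fun i j : Fin 2 => if i.val + j.val + 1 = 2 then (1 : L) else 0)).Local v × (cmDatum L 1 (Matrix.of fun i j : Fin 1 => if i.val + j.val + 1 = 1 then (1 : L) else 0)).Local v)).1.val.val : Matrix (Fin 2) (Fin 2) (LocalRing L v)) * P.val) 1 1) w))).toNat →
        toPlace v w ((b₀ t : (v.adicCompletion ↥(maximalRealSubfield L))ˣ) : v.adicCompletion ↥(maximalRealSubfield L)) = (((P⁻¹).val * ((t : ((cmDatum L 2 (Matrix.of fun i j : Fin 2 => if i.val + j.val + 1 = 2 then (1 : L) else 0)).Local v × (cmDatum L 1 (Matrix.of fun i j : Fin 1 => if i.val + j.val + 1 = 1 then (1 : L) else 0)).Local v)).1.val.val : Matrix (Fin 2) (Fin 2) (LocalRing L v)) * P.val) 0 0 w / ((P⁻¹).val * ((t : ((cmDatum L 2 (Matrix.of fun i j : Fin 2 => if i.val + j.val + 1 = 2 then (1 : L) else 0)).Local v × (cmDatum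 L 1 (Matrix.of fun i j : Fin 1 => if i.val + j.val + 1 = 1 then (1 : L) else 0)).Local v)).1.val.val : Matrix (Fin 2) (Fin 2) (LocalRing L v)) * P.val) 1 1 w - 1) / ((((P⁻¹).val * ((t : ((cmDatum L 2 (Matrix.of fun i j : Fin 2 => if i.val + j.val + 1 = 2 then (1 : L) else 0)).Local v × (cmDatum L 1 (Matrix.of fun i j : Fin 1 => if i.val + j.val + 1 = 1 then (1 : L) else 0)).Local v)).1.val.val : Matrix (Fin 2) (Fin 2) (LocalRing L v)) * P.val) 0 0 w / ((P⁻¹).val * ((t : ((cmDatum L 2 (Matrix.of fun i j : Fin 2 => if i.val + j.val + 1 = 2 then (1 : L) else 0)).Local v × (cmDatum L 1 (Matrix.of fun i j : Fin 1 => if i.val + j.val + 1 = 1 then (1 : L) else 0)).Local v)).1.val.val : Matrix (Fin 2) (Fin 2) (LocalRing L v)) * P.val) 1 1 w + 1) * η) ∧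
        toPlace v w ((bc t : (v.adicCompletion ↥(maximalRealSubfield L))ˣ) : v.adicCompletion ↥(maximalRealSubfield L)) = (((P⁻¹).val * ((t : ((cmDatum L 2 (Matrix.of fun i j : Fin 2 => if i.val + j.val + 1 = 2 then (1 : L) else 0)).Local v × (cmDatum L 1 (Matrix.of fun i j : Fin 1 => if i.val + j.val + 1 = 1 then (1 : L) else 0)).Local v)).1.val.val : Matrix (Fin 2) (Fin 2) (LocalRing L v)) * P.val) 0 0 w / ((P⁻¹).val * ((t : ((cmDatum L 2 (Matrix.of fun i j : Fin 2 => if i.val + j.val + 1 = 2 then (1 : L) else 0)).Local v × (cmDatum L 1 (Matrix.of fun i j : Fin 1 => if i.val + j.val + 1 = 1 then (1 : L) else 0)).Local v)).1.val.val : Matrix (Fin 2) (Fin 2) (LocalRing L v)) * P.val) 1 1 w - ((P⁻¹).val * ((t : ((cmDatum L 2 (Matrix.of fun i j : Fin 2 => if i.val + j.val + 1 = 2 then (1 : L) else 0)).Local v × (cmDatum L 1 (Matrix.of fun i j : Fin 1 => if i.val + j.val + 1 = 1 then (1 : L) else 0)).Local v)).1.val.val : Matrix (Fin 2) (Fin 2)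 (LocalRing L v)) * P.val) 1 1 w / ((P⁻¹).val * ((t : ((cmDatum L 2 (Matrix.of fun i j : Fin 2 => if i.val + j.val + 1 = 2 then (1 : L) else 0)).Local v × (cmDatum L 1 (Matrix.of fun i j : Fin 1 => if i.val + j.val + 1 = 1 then (1 : L) else 0)).Local v)).1.val.val : Matrix (Fin 2) (Fin 2) (LocalRing L v)) * P.val) 0 0 w) / η ∧
        toPlace v w ((tc t : (v.adicCompletion ↥(maximalRealSubfield L))ˣ) : v.adicCompletion ↥(maximalRealSubfield L)) = ((P⁻¹).val * ((t : ((cmDatum L 2 (Matrix.of fun i j : Fin 2 => if i.val + j.val + 1 = 2 then (1 : L) else 0)).Local v × (cmDatum L 1 (Matrix.of fun i j : Fin 1 => if i.val + j.val + 1 = 1 then (1 : L) else 0)).Local v)).1.val.val : Matrix (Fin 2) (Fin 2) (LocalRing L v)) * P.val) 0 0 w / ((P⁻¹).val * ((t : ((cmDatum L 2 (Matrix.of fun i j : Fin 2 => if i.val + j.val + 1 = 2 then (1 : L) else 0)).Local v × (cmDatum L 1 (Matrix.of fun i j : Fin 1 => if i.val + j.val + 1 = 1 then (1 : L) else 0)).Local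 v)).1.val.val : Matrix (Fin 2) (Fin 2) (LocalRing L v)) * P.val) 1 1 w + ((P⁻¹).val * ((t : ((cmDatum L 2 (Matrix.of fun i j : Fin 2 => if i.val + j.val + 1 = 2 then (1 : L) else 0)).Local v × (cmDatum L 1 (Matrix.of fun i j : Fin 1 => if i.val + j.val + 1 = 1 then (1 : L) else 0)).Local v)).1.val.val : Matrix (Fin 2) (Fin 2) (LocalRing L v)) * P.val) 1 1 w / ((P⁻¹).val * ((t : ((cmDatum L 2 (Matrix.of fun i j : Fin 2 => if i.val + j.val + 1 = 2 then (1 : L) else 0)).Local v × (cmDatum L 1 (Matrix.of fun i j : Fin 1 => if i.val + j.val + 1 = 1 then (1 : L) else 0)).Local v)).1.val.val : Matrix (Fin 2) (Fin 2) (LocalRing L v)) * P.val) 0 0 w + 2) ∧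
      (∀ s : ↥(Subgroup.centralizer ({t₀} : Set ((cmDatum L 2 (Matrix.of fun i j : Fin 2 => if i.val + j.val + 1 = 2 then (1 : L) else 0)).Local v × (cmDatum L 1 (Matrix.of fun i j : Fin 1 => if i.val + j.val + 1 = 1 then (1 : L) else 0)).Local v))), ¬ IsRegularElt ((s : ((cmDatum L 2 (Matrix.of fun i j : Fin 2 => if i.val + j.val + 1 = 2 then (1 : L) else 0)).Local v × (cmDatum L 1 (Matrix.of fun i j : Fin 1 => if i.val + j.val + 1 = 1 then (1 : L) else 0)).Local v)).1.val : GL (Fin 2) (LocalRing L v)) → ∀ᶠ (t : ↥(Subgroup.centralizer ({t₀} : Set ((cmDatum L 2 (Matrix.of fun i j : Fin 2 => if i.val + j.val + 1 = 2 then (1 : L) else 0)).Local v × (cmDatum L 1 (Matrix.of fun i j : Fin 1 => if i.val + j.val + 1 = 1 then (1 : L) else 0)).Local v)))) in 𝓝 s, t ∈ {t : ↥(Subgroup.centralizer ({t₀} : Set ((cmDatum L 2 (Matrix.of fun i j : Fin 2 => if i.val + j.val + 1 = 2 then (1 : L) else 0)).Local v × (cmDatum L 1 (Matrix.of fun i j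 : Fin 1 => if i.val + j.val + 1 = 1 then (1 : L) else 0)).Local v))) | IsRegularElt ((t : ((cmDatum L 2 (Matrix.of fun i j : Fin 2 => if i.val + j.val + 1 = 2 then (1 : L) else 0)).Local v × (cmDatum L 1 (Matrix.of fun i j : Fin 1 => if i.val + j.val + 1 = 1 then (1 : L) else 0)).Local v)).1.val : GL (Fin 2) (LocalRing L v))} → book t = book s) ∧
      ∀ t : ↥(Subgroup.centralizer ({t₀} : Set ((cmDatum L 2 (Matrix.of fun i j : Fin 2 => if i.val + j.val + 1 = 2 then (1 : L) else 0)).Local v × (cmDatum L 1 (Matrix.of fun i j : Fin 1 => if i.val + j.val + 1 = 1 then (1 : L) else 0)).Local v))), t ∈ {t : ↥(Subgroup.centralizer ({t₀} : Set ((cmDatum L 2 (Matrix.of fun i j : Fin 2 => if i.val + j.val + 1 = 2 then (1 : L) else 0)).Local v × (cmDatum L 1 (Matrix.of fun i j : Fin 1 => if i.val + j.val + 1 = 1 then (1 : L) else 0)).Local v))) | IsRegularElt ((t : ((cmDatum L 2 (Matrix.of fun i j : Fin 2 => if i.val + j.val + 1 = 2 then (1 : L) else 0)).Local v × (cmDatum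 L 1 (Matrix.of fun i j : Fin 1 => if i.val + j.val + 1 = 1 then (1 : L) else 0)).Local v)).1.val : GL (Fin 2) (LocalRing L v))} → Nb ≤ (-WithZero.log (Valued.v ((((P⁻¹).val * ((t : ((cmDatum L 2 (Matrix.of fun i j : Fin 2 => if i.val + j.val + 1 = 2 then (1 : L) else 0)).Local v × (cmDatum L 1 (Matrix.of fun i j : Fin 1 => if i.val + j.val + 1 = 1 then (1 : L) else 0)).Local v)).1.val.val : Matrix (Fin 2) (Fin 2) (LocalRing L v)) * P.val) 0 0 - ((P⁻¹).val * ((t : ((cmDatum L 2 (Matrix.of fun i j : Fin 2 => if i.val + j.val + 1 = 2 then (1 : L) else 0)).Local v × (cmDatum L 1 (Matrix.of fun i j : Fin 1 => if i.val + j.val + 1 = 1 then (1 : L) else 0)).Local v)).1.val.val : Matrix (Fin 2) (Fin 2) (LocalRing L v)) * P.val) 1 1) w))).toNat →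
        book t = ((hilbertSymbol (v.adicCompletion ↥(maximalRealSubfield L)) ((b₀ t : (v.adicCompletion ↥(maximalRealSubfield L))ˣ) : v.adicCompletion ↥(maximalRealSubfield L)) (algebraMap ↥(maximalRealSubfield L) _ ((cmQuadraticGenerator L : 𝓞 ↥(maximalRealSubfield L)) : ↥(maximalRealSubfield L))) : ℤ) : ℂ) * ((hilbertSymbol (v.adicCompletion ↥(maximalRealSubfield L)) ((bc t : (v.adicCompletion ↥(maximalRealSubfield L))ˣ) : v.adicCompletion ↥(maximalRealSubfield L)) (algebraMap ↥(maximalRealSubfield L) _ ((cmQuadraticGenerator L : 𝓞 ↥(maximalRealSubfield L)) : ↥(maximalRealSubfield L))) : ℤ) : ℂ) * (Nat.card (𝓞 ↥(maximalRealSubfield L) ⧸ v.asIdeal) : ℂ) ^ (-WithZero.log (Valued.v ((bc t : (v.adicCompletion ↥(maximalRealSubfield L))ˣ) : v.adicCompletion ↥(maximalRealSubfield L)))).toNat * ((Nat.card (𝓞 ↥(maximalRealSubfield L) ⧸ v.asIdeal) : ℂ) ^ (((-WithZero.log (Valued.v ((((P⁻¹).val * ((t : ((cmDatum L 2 (Matrix.of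 fun i j : Fin 2 => if i.val + j.val + 1 = 2 then (1 : L) else 0)).Local v × (cmDatum L 1 (Matrix.of fun i j : Fin 1 => if i.val + j.val + 1 = 1 then (1 : L) else 0)).Local v)).1.val.val : Matrix (Fin 2) (Fin 2) (LocalRing L v)) * P.val) 0 0 - ((P⁻¹).val * ((t : ((cmDatum L 2 (Matrix.of fun i j : Fin 2 => if i.val + j.val + 1 = 2 then (1 : L) else 0)).Local v × (cmDatum L 1 (Matrix.of fun i j : Fin 1 => if i.val + j.val + 1 = 1 then (1 : L) else 0)).Local v)).1.val.val : Matrix (Fin 2) (Fin 2) (LocalRing L v)) * P.val) 1 1) w))).toNat - 1) / 2))⁻¹ := by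
  obtain ⟨Nb, b₀, bc, tc, K, -, hspec, hK⟩ := exists_const_bookProduct L v w hw he t₀ P d ht₀ hP hd1 hση hη0
  exact ⟨Nb, b₀, bc, tc, fun _ => K, fun t ht hN => hspec t ht hN, fun s _ => Filter.Eventually.of_forall fun t _ => rfl, fun t ht hN => (hK t ht hN).symm⟩

omit hw he ht₀ hP hd1 in
/-- **READING THE (W′-B6) DEPTH SPEC**: `|ι_w bc|_w = exp(−2·o)` (F0P3-p01 (g14)'s `hoβ`) forces `o = (−log|bc|_v).toNat` at a ramified place (`|ι_w y|_w = |y|_v²`).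
[cite: LabesseLanglands1979, §2 (2.2) p. 9] -/
theorem toNat_neg_log_eq_of_valued_toPlace_eq_exp (he : v.asIdeal.ramificationIdx' w.1.asIdeal ≠ 1) (hw : IsCMField.complexConj L • w.1 = w.1)
    {bc : (v.adicCompletion ↥(maximalRealSubfield L))ˣ} {o : ℕ} (ho : Valued.v (toPlace v w ((bc : (v.adicCompletion ↥(maximalRealSubfield L))ˣ) : v.adicCompletion ↥(maximalRealSubfield L))) = WithZero.exp (-(2 * (o : ℤ)))) :
    (-WithZero.log (Valued.v ((bc : (v.adicCompletion ↥(maximalRealSubfield L))ˣ) : v.adicCompletion ↥(maximalRealSubfield L)))).toNat = o := by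
  have hc1 : IsCMField.complexConj L ≠ 1 := IsCMField.complexConj_ne_one L
  have he2 : v.asIdeal.ramificationIdx' w.1.asIdeal = 2 := Liu2021.LemD1IndexedNonVacuityRamifiedPlace.ramificationIdx'_eq_two_of_ne_one L v (IsCMField.complexConj L) hc1 w hw he
  rw [valued_toPlace, he2] at ho
  have hbcv : Valued.v ((bc : (v.adicCompletion ↥(maximalRealSubfield L))ˣ) : v.adicCompletion ↥(maximalRealSubfield L)) ≠ 0 := (Valuation.ne_zero_iff _).2 bc.ne_zero
  have hlog := congrArg WithZero.log ho
  rw [WithZero.log_pow, WithZero.log_exp, nsmul_eq_mul, Nat.cast_ofNat] at hlog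
  have : WithZero.log (Valued.v ((bc : (v.adicCompletion ↥(maximalRealSubfield L))ˣ) : v.adicCompletion ↥(maximalRealSubfield L))) = -(o : ℤ) := by linarith
  rw [this, neg_neg, Int.toNat_natCast]

-- `L_w`-sized statement: elaboration budget only (no search)
set_option maxHeartbeats 1600000 in
/-- **(Ψ4-book) IN THE (W′-B6) CONTRACT'S CURRENCY** (F0P3-p01 (g14) v1 24e03b6f: `κβ`, `oβ` are OUTPUTS specified against the difference coordinate `bc` by
`hκβ : κβ t = ((bc t, θ)_v : ℂ)` and `hoβ : |ι_w (bc t)|_w = exp(−2·oβ t)` on the deep regular locus): with the coordinate functions and the constant `K ≠ 0` exported here,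
for ANY such `κβ, oβ` (threshold `m₁`) and every regular `t` with `Nb ≤ N t`, `m₁ ≤ N t`:  `(b₀ t, θ)_v · κβ t · q^(oβ t) · (q^((N t − 1)∕2))⁻¹ = K` — so the (γ) layer's
`book := fun _ => K`, `hbook` := constancy, `hbookU` := this clause at `m₀ := max m₀ Nb m₁`, and `ε t := ((b₀ t, θ)_v : ℂ)` is the SAME `b₀` the `Δ`-side (A-p19 (g23)) reads.
[cite: LabesseLanglands1979, §2 (2.2) p. 9] [cite: Labesse2024StabilisationGermesSL2, Prop. 0.0.11, Th. 0.0.12] [cite: Rogawski1990, §4.9 Lemma 4.9.3 (4.9.2) p. 56] -/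
theorem exists_book_of_wildLaw {η : w.1.adicCompletion L} (hση : galAdicCompletionMap (L := L) (IsCMField.complexConj L) hw η = -η) (hη0 : η ≠ 0) :
    ∃ (Nb : ℕ) (b₀ bc tc : ↥(Subgroup.centralizer ({t₀} : Set ((cmDatum L 2 (Matrix.of fun i j : Fin 2 => if i.val + j.val + 1 = 2 then (1 : L) else 0)).Local v × (cmDatum L 1 (Matrix.of fun i j : Fin 1 => if i.val + j.val + 1 = 1 then (1 : L) else 0)).Local v))) → (v.adicCompletion ↥(maximalRealSubfield L))ˣ) (K : ℂ), K ≠ 0 ∧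
      (∀ t : ↥(Subgroup.centralizer ({t₀} : Set ((cmDatum L 2 (Matrix.of fun i j : Fin 2 => if i.val + j.val + 1 = 2 then (1 : L) else 0)).Local v × (cmDatum L 1 (Matrix.of fun i j : Fin 1 => if i.val + j.val + 1 = 1 then (1 : L) else 0)).Local v))), IsRegularElt ((t : ((cmDatum L 2 (Matrix.of fun i j : Fin 2 => if i.val + j.val + 1 = 2 then (1 : L) else 0)).Local v × (cmDatum L 1 (Matrix.of fun i j : Fin 1 => if i.val + j.val + 1 = 1 then (1 : L) else 0)).Local v)).1.val : GL (Fin 2) (LocalRing L v)) → Nb ≤ (-WithZero.log (Valued.v ((((P⁻¹).val * ((t : ((cmDatum L 2 (Matrix.of fun i j : Fin 2 => if i.val + j.val + 1 = 2 then (1 : L) else 0)).Local v × (cmDatum L 1 (Matrix.of fun i j : Fin 1 => if i.val + j.val + 1 = 1 then (1 : L) else 0)).Local v)).1.val.val : Matrix (Fin 2) (Fin 2) (LocalRing L v)) * P.val) 0 0 - ((P⁻¹).val * ((t : ((cmDatum L 2 (Matrix.of fun i j : Fin 2 => if i.val + j.val + 1 = 2 then (1 : L) else 0)).Local v × (cmDatum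 L 1 (Matrix.of fun i j : Fin 1 => if i.val + j.val + 1 = 1 then (1 : L) else 0)).Local v)).1.val.val : Matrix (Fin 2) (Fin 2) (LocalRing L v)) * P.val) 1 1) w))).toNat →
        toPlace v w ((b₀ t : (v.adicCompletion ↥(maximalRealSubfield L))ˣ) : v.adicCompletion ↥(maximalRealSubfield L)) = (((P⁻¹).val * ((t : ((cmDatum L 2 (Matrix.of fun i j : Fin 2 => if i.val + j.val + 1 = 2 then (1 : L) else 0)).Local v × (cmDatum L 1 (Matrix.of fun i j : Fin 1 => if i.val + j.val + 1 = 1 then (1 : L) else 0)).Local v)).1.val.val : Matrix (Fin 2) (Fin 2) (LocalRing L v)) * P.val) 0 0 w / ((P⁻¹).val * ((t : ((cmDatum L 2 (Matrix.of fun i j : Fin 2 => if i.val + j.val + 1 = 2 then (1 : L) else 0)).Local v × (cmDatum L 1 (Matrix.of fun i j : Fin 1 => if i.val + j.val + 1 = 1 then (1 : L) else 0)).Local v)).1.val.val : Matrix (Fin 2) (Fin 2) (LocalRing L v)) * P.val) 1 1 w - 1) / ((((P⁻¹).val * ((t : ((cmDatum L 2 (Matrix.of fun i j : Fin 2 =>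 if i.val + j.val + 1 = 2 then (1 : L) else 0)).Local v × (cmDatum L 1 (Matrix.of fun i j : Fin 1 => if i.val + j.val + 1 = 1 then (1 : L) else 0)).Local v)).1.val.val : Matrix (Fin 2) (Fin 2) (LocalRing L v)) * P.val) 0 0 w / ((P⁻¹).val * ((t : ((cmDatum L 2 (Matrix.of fun i j : Fin 2 => if i.val + j.val + 1 = 2 then (1 : L) else 0)).Local v × (cmDatum L 1 (Matrix.of fun i j : Fin 1 => if i.val + j.val + 1 = 1 then (1 : L) else 0)).Local v)).1.val.val : Matrix (Fin 2) (Fin 2) (LocalRing L v)) * P.val) 1 1 w + 1) * η) ∧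
        toPlace v w ((bc t : (v.adicCompletion ↥(maximalRealSubfield L))ˣ) : v.adicCompletion ↥(maximalRealSubfield L)) = (((P⁻¹).val * ((t : ((cmDatum L 2 (Matrix.of fun i j : Fin 2 => if i.val + j.val + 1 = 2 then (1 : L) else 0)).Local v × (cmDatum L 1 (Matrix.of fun i j : Fin 1 => if i.val + j.val + 1 = 1 then (1 : L) else 0)).Local v)).1.val.val : Matrix (Fin 2) (Fin 2) (LocalRing L v)) * P.val) 0 0 w / ((P⁻¹).val * ((t : ((cmDatum L 2 (Matrix.of fun i j : Fin 2 => if i.val + j.val + 1 = 2 then (1 : L) else 0)).Local v × (cmDatum L 1 (Matrix.of fun i j : Fin 1 => if i.val + j.val + 1 = 1 then (1 : L) else 0)).Local v)).1.val.val : Matrix (Fin 2) (Fin 2) (LocalRing L v)) * P.val) 1 1 w - ((P⁻¹).val * ((t : ((cmDatum L 2 (Matrix.of fun i j : Fin 2 => if i.val + j.val + 1 = 2 then (1 : L) else 0)).Local v × (cmDatum L 1 (Matrix.of fun i j : Fin 1 => if i.val + j.val + 1 = 1 then (1 : L) else 0)).Local v)).1.val.val : Matrix (Fin 2) (Fin 2)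 (LocalRing L v)) * P.val) 1 1 w / ((P⁻¹).val * ((t : ((cmDatum L 2 (Matrix.of fun i j : Fin 2 => if i.val + j.val + 1 = 2 then (1 : L) else 0)).Local v × (cmDatum L 1 (Matrix.of fun i j : Fin 1 => if i.val + j.val + 1 = 1 then (1 : L) else 0)).Local v)).1.val.val : Matrix (Fin 2) (Fin 2) (LocalRing L v)) * P.val) 0 0 w) / η ∧
        toPlace v w ((tc t : (v.adicCompletion ↥(maximalRealSubfield L))ˣ) : v.adicCompletion ↥(maximalRealSubfield L)) = ((P⁻¹).val * ((t : ((cmDatum L 2 (Matrix.of fun i j : Fin 2 => if i.val + j.val + 1 = 2 then (1 : L) else 0)).Local v × (cmDatum L 1 (Matrix.of fun i j : Fin 1 => if i.val + j.val + 1 = 1 then (1 : L) else 0)).Local v)).1.val.val : Matrix (Fin 2) (Fin 2) (LocalRing L v)) * P.val) 0 0 w / ((P⁻¹).val * ((t : ((cmDatum L 2 (Matrix.of fun i j : Fin 2 => if i.val + j.val + 1 = 2 then (1 : L) else 0)).Local v × (cmDatum L 1 (Matrix.of fun i j : Fin 1 => if i.val + j.val + 1 = 1 then (1 : L) else 0)).Local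 v)).1.val.val : Matrix (Fin 2) (Fin 2) (LocalRing L v)) * P.val) 1 1 w + ((P⁻¹).val * ((t : ((cmDatum L 2 (Matrix.of fun i j : Fin 2 => if i.val + j.val + 1 = 2 then (1 : L) else 0)).Local v × (cmDatum L 1 (Matrix.of fun i j : Fin 1 => if i.val + j.val + 1 = 1 then (1 : L) else 0)).Local v)).1.val.val : Matrix (Fin 2) (Fin 2) (LocalRing L v)) * P.val) 1 1 w / ((P⁻¹).val * ((t : ((cmDatum L 2 (Matrix.of fun i j : Fin 2 => if i.val + j.val + 1 = 2 then (1 : L) else 0)).Local v × (cmDatum L 1 (Matrix.of fun i j : Fin 1 => if i.val + j.val + 1 = 1 then (1 : L) else 0)).Local v)).1.val.val : Matrix (Fin 2) (Fin 2) (LocalRing L v)) * P.val) 0 0 w + 2) ∧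
      ∀ (κβ : ↥(Subgroup.centralizer ({t₀} : Set ((cmDatum L 2 (Matrix.of fun i j : Fin 2 => if i.val + j.val + 1 = 2 then (1 : L) else 0)).Local v × (cmDatum L 1 (Matrix.of fun i j : Fin 1 => if i.val + j.val + 1 = 1 then (1 : L) else 0)).Local v))) → ℂ) (oβ : ↥(Subgroup.centralizer ({t₀} : Set ((cmDatum L 2 (Matrix.of fun i j : Fin 2 => if i.val + j.val + 1 = 2 then (1 : L) else 0)).Local v × (cmDatum L 1 (Matrix.of fun i j : Fin 1 => if i.val + j.val + 1 = 1 then (1 : L) else 0)).Local v))) → ℕ) (m₁ : ℕ),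
        (∀ t : ↥(Subgroup.centralizer ({t₀} : Set ((cmDatum L 2 (Matrix.of fun i j : Fin 2 => if i.val + j.val + 1 = 2 then (1 : L) else 0)).Local v × (cmDatum L 1 (Matrix.of fun i j : Fin 1 => if i.val + j.val + 1 = 1 then (1 : L) else 0)).Local v))), t ∈ {t : ↥(Subgroup.centralizer ({t₀} : Set ((cmDatum L 2 (Matrix.of fun i j : Fin 2 => if i.val + j.val + 1 = 2 then (1 : L) else 0)).Local v × (cmDatum L 1 (Matrix.of fun i j : Fin 1 => if i.val + j.val + 1 = 1 then (1 : L) else 0)).Local v))) | IsRegularElt ((t : ((cmDatum L 2 (Matrix.of fun i j : Fin 2 => if i.val + j.val + 1 = 2 then (1 : L) else 0)).Local v × (cmDatum L 1 (Matrix.of fun i j : Fin 1 => if i.val + j.val + 1 = 1 then (1 : L) else 0)).Local v)).1.val : GL (Fin 2) (LocalRing L v))} → m₁ ≤ (-WithZero.log (Valued.v ((((P⁻¹).val * ((t : ((cmDatum L 2 (Matrix.of fun i j : Fin 2 => if i.val + j.val + 1 = 2 then (1 : L) else 0)).Local v × (cmDatum L 1 (Matrix.of fun i j : Fin 1 =>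 if i.val + j.val + 1 = 1 then (1 : L) else 0)).Local v)).1.val.val : Matrix (Fin 2) (Fin 2) (LocalRing L v)) * P.val) 0 0 - ((P⁻¹).val * ((t : ((cmDatum L 2 (Matrix.of fun i j : Fin 2 => if i.val + j.val + 1 = 2 then (1 : L) else 0)).Local v × (cmDatum L 1 (Matrix.of fun i j : Fin 1 => if i.val + j.val + 1 = 1 then (1 : L) else 0)).Local v)).1.val.val : Matrix (Fin 2) (Fin 2) (LocalRing L v)) * P.val) 1 1) w))).toNat → κβ t = ((hilbertSymbol (v.adicCompletion ↥(maximalRealSubfield L)) ((bc t : (v.adicCompletion ↥(maximalRealSubfield L))ˣ) : v.adicCompletion ↥(maximalRealSubfield L)) (algebraMap ↥(maximalRealSubfield L) _ ((cmQuadraticGenerator L : 𝓞 ↥(maximalRealSubfield L)) : ↥(maximalRealSubfield L))) : ℤ) : ℂ)) →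
        (∀ t : ↥(Subgroup.centralizer ({t₀} : Set ((cmDatum L 2 (Matrix.of fun i j : Fin 2 => if i.val + j.val + 1 = 2 then (1 : L) else 0)).Local v × (cmDatum L 1 (Matrix.of fun i j : Fin 1 => if i.val + j.val + 1 = 1 then (1 : L) else 0)).Local v))), t ∈ {t : ↥(Subgroup.centralizer ({t₀} : Set ((cmDatum L 2 (Matrix.of fun i j : Fin 2 => if i.val + j.val + 1 = 2 then (1 : L) else 0)).Local v × (cmDatum L 1 (Matrix.of fun i j : Fin 1 => if i.val + j.val + 1 = 1 then (1 : L) else 0)).Local v))) | IsRegularElt ((t : ((cmDatum L 2 (Matrix.of fun i j : Fin 2 => if i.val + j.val + 1 = 2 then (1 : L) else 0)).Local v × (cmDatum L 1 (Matrix.of fun i j : Fin 1 => if i.val + j.val + 1 = 1 then (1 : L) else 0)).Local v)).1.val : GL (Fin 2) (LocalRing L v))} → m₁ ≤ (-WithZero.log (Valued.v ((((P⁻¹).val * ((t : ((cmDatum L 2 (Matrix.of fun i j : Fin 2 => if i.val + j.val + 1 = 2 then (1 : L) else 0)).Local v × (cmDatum L 1 (Matrix.of fun i j : Fin 1 =>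 if i.val + j.val + 1 = 1 then (1 : L) else 0)).Local v)).1.val.val : Matrix (Fin 2) (Fin 2) (LocalRing L v)) * P.val) 0 0 - ((P⁻¹).val * ((t : ((cmDatum L 2 (Matrix.of fun i j : Fin 2 => if i.val + j.val + 1 = 2 then (1 : L) else 0)).Local v × (cmDatum L 1 (Matrix.of fun i j : Fin 1 => if i.val + j.val + 1 = 1 then (1 : L) else 0)).Local v)).1.val.val : Matrix (Fin 2) (Fin 2) (LocalRing L v)) * P.val) 1 1) w))).toNat → Valued.v (toPlace v w ((bc t : (v.adicCompletion ↥(maximalRealSubfield L))ˣ) : v.adicCompletion ↥(maximalRealSubfield L))) = WithZero.exp (-(2 * (oβ t : ℤ)))) →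
        ∀ t : ↥(Subgroup.centralizer ({t₀} : Set ((cmDatum L 2 (Matrix.of fun i j : Fin 2 => if i.val + j.val + 1 = 2 then (1 : L) else 0)).Local v × (cmDatum L 1 (Matrix.of fun i j : Fin 1 => if i.val + j.val + 1 = 1 then (1 : L) else 0)).Local v))), t ∈ {t : ↥(Subgroup.centralizer ({t₀} : Set ((cmDatum L 2 (Matrix.of fun i j : Fin 2 => if i.val + j.val + 1 = 2 then (1 : L) else 0)).Local v × (cmDatum L 1 (Matrix.of fun i j : Fin 1 => if i.val + j.val + 1 = 1 then (1 : L) else 0)).Local v))) | IsRegularElt ((t : ((cmDatum L 2 (Matrix.of fun i j : Fin 2 => if i.val + j.val + 1 = 2 then (1 : L) else 0)).Local v × (cmDatum L 1 (Matrix.of fun i j : Fin 1 => if i.val + j.val + 1 = 1 then (1 : L) else 0)).Local v)).1.val : GL (Fin 2) (LocalRing L v))} → Nb ≤ (-WithZero.log (Valued.v ((((P⁻¹).val * ((t : ((cmDatum L 2 (Matrix.of fun i j : Fin 2 => if i.val + j.val + 1 = 2 then (1 : L) else 0)).Local v × (cmDatum L 1 (Matrix.of fun i j : Fin 1 => if i.val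 + j.val + 1 = 1 then (1 : L) else 0)).Local v)).1.val.val : Matrix (Fin 2) (Fin 2) (LocalRing L v)) * P.val) 0 0 - ((P⁻¹).val * ((t : ((cmDatum L 2 (Matrix.of fun i j : Fin 2 => if i.val + j.val + 1 = 2 then (1 : L) else 0)).Local v × (cmDatum L 1 (Matrix.of fun i j : Fin 1 => if i.val + j.val + 1 = 1 then (1 : L) else 0)).Local v)).1.val.val : Matrix (Fin 2) (Fin 2) (LocalRing L v)) * P.val) 1 1) w))).toNat → m₁ ≤ (-WithZero.log (Valued.v ((((P⁻¹).val * ((t : ((cmDatum L 2 (Matrix.of fun i j : Fin 2 => if i.val + j.val + 1 = 2 then (1 : L) else 0)).Local v × (cmDatum L 1 (Matrix.of fun i j : Fin 1 => if i.val + j.val + 1 = 1 then (1 : L) else 0)).Local v)).1.val.val : Matrix (Fin 2) (Fin 2) (LocalRing L v)) * P.val) 0 0 - ((P⁻¹).val * ((t : ((cmDatum L 2 (Matrix.of fun i j : Fin 2 => if i.val + j.val + 1 = 2 then (1 : L) else 0)).Local v × (cmDatum L 1 (Matrix.of fun i j : Fin 1 => if i.val + j.val + 1 = 1 then (1 : L)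 else 0)).Local v)).1.val.val : Matrix (Fin 2) (Fin 2) (LocalRing L v)) * P.val) 1 1) w))).toNat →
          ((hilbertSymbol (v.adicCompletion ↥(maximalRealSubfield L)) ((b₀ t : (v.adicCompletion ↥(maximalRealSubfield L))ˣ) : v.adicCompletion ↥(maximalRealSubfield L)) (algebraMap ↥(maximalRealSubfield L) _ ((cmQuadraticGenerator L : 𝓞 ↥(maximalRealSubfield L)) : ↥(maximalRealSubfield L))) : ℤ) : ℂ) * κβ t * (Nat.card (𝓞 ↥(maximalRealSubfield L) ⧸ v.asIdeal) : ℂ) ^ (oβ t) * ((Nat.card (𝓞 ↥(maximalRealSubfield L) ⧸ v.asIdeal) : ℂ) ^ (((-WithZero.log (Valued.v ((((P⁻¹).val * ((t : ((cmDatum L 2 (Matrix.of fun i j : Fin 2 => if i.val + j.val + 1 = 2 then (1 : L) else 0)).Local v × (cmDatum L 1 (Matrix.of fun i j : Fin 1 => if i.val + j.val + 1 = 1 then (1 : L) else 0)).Local v)).1.val.val : Matrix (Fin 2) (Fin 2) (LocalRing L v)) * P.val) 0 0 - ((P⁻¹).val * ((t : ((cmDatum L 2 (Matrix.of fun i j :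 Fin 2 => if i.val + j.val + 1 = 2 then (1 : L) else 0)).Local v × (cmDatum L 1 (Matrix.of fun i j : Fin 1 => if i.val + j.val + 1 = 1 then (1 : L) else 0)).Local v)).1.val.val : Matrix (Fin 2) (Fin 2) (LocalRing L v)) * P.val) 1 1) w))).toNat - 1) / 2))⁻¹ = K := by
  obtain ⟨Nb, b₀, bc, tc, K, hK0, hspec, hK⟩ := exists_const_bookProduct L v w hw he t₀ P d ht₀ hP hd1 hση hη0
  refine ⟨Nb, b₀, bc, tc, K, hK0, hspec, fun κβ oβ m₁ hκβ hoβ t ht hNb hm₁ => ?_⟩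
  rw [hκβ t ht hm₁, ← toNat_neg_log_eq_of_valued_toPlace_eq_exp L v w he hw (hoβ t ht hm₁)]
  exact hK t ht hNb

end Torus

end Literature.NumberTheory.Rogawski1990

end
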